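import Summits.KontsevichZagierPeriods.KontsevichZagierPeriods.Theses.SymplecticScissors
import Literature.NumberTheory.Transcendental.SemialgebraicMapsProofs

/-!
# Disproof of `PlanarCompiler` — crux stmt-KontsevichZagierPeriods-10058 (route SymplecticScissors, rank 2)

Standing-adversary work file (refuter `cdisprove`, gen 1 / cycle 1 and gen 2 / cycle 2, 2026-08-16).
`lean check`: rc 0, 0 `sorry`, 0 warnings; axioms ⊆ {propext, Classical.choice, Quot.sound}. Imports
only the route file. Namespace `…Cruxes.PlanarCompiler.Disproof`.

## Verdict (cycle 2, gen 2): STILL NO KILL; the PICKED line survives every cheap attack, and its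
## two delicate hypotheses are now CERTIFIED NECESSARY (§6, §7 below; landed under Negative/).

Cycle 2 was run against the PICKED line `twist-restoring-shear` (PICKED.md; lead skeleton
`Lines/twist-restoring-shear.lean`, sha a84852d9, `λ = 0`, 7 stubs; planner variants f9f84b9a / v2
registered on the item). All seven stubs are TRUE on paper (independently: drefute
`DrefuteTwistRestoringShear.md`, 7/7 survived) — read-back in NOTES §Targets: cellCompiler (cells
semialgebraic by Tarski–Seidenberg, finite area by Tonelli), normalForm (CAD bands + vertical shears,
null verticals die, off-domain junk harmless by §3), elementaryMoves (grading; 1a literal; 1b six sign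
patterns = StackingShear; rule 2 = FiniteMapShear on monotonicity pieces, `deriv` of a semialgebraic
function is semialgebraic — tree `hasDerivAt_isSemialgebraic_holds`), shearedTransport (= 9852),
signedSweep (vertical sign-CAD refined until the graph functions are MONOTONE), band (signed
indicator identity by 1a after sign subdivision), greenAssembly (degree/telescoping formula for
piecewise-monotone continuous fibre maps; multiplicities by 1a inclusion–exclusion; the `λ`-term, if
any, is two congruent triangles). What the refuter ADDS, as theorems:
* §6 ENGINE LOAD-BEARING (`stub_shearedTransport`, the lever): each of closedness `∂_bA = ∂_aB`,
  `InjOn Ψ₂`, `InjOn Ψ₁` is necessary — the stub with that hypothesis deleted is FALSE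
  (`not_shearedTransportWithoutClosed`: `A = 2b, B = a` on `(0,1)²`, areas `2 ≠ 1`;
  `not_shearedTransportWithoutInj₂`: `S = a²b` on `((−1,0)∪(0,1)) × (0,1)`, the horizontal sweep
  `(b, a²)` folds, areas `2 ≠ 1`; `not_shearedTransportWithoutInj₁`: mirror datum `S = ab²`).
* §7 THE SIGN CELL CAN FOLD (`stub_signedSweep`): its clause "monotone graph functions" is
  load-bearing — `not_posTwistBandSweepInjective`: for the polynomial datum
  `S = a³b − (3/2)a²b + ab²/2 + ab/2` the twist-positive cell over the middle interval
  (`{β(a) < b < 1 − a}`, `β = −3a² + 3a − ½` the zero-twist curve, NOT monotone) has `Ψ₁ = (a, A)`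
  injective (`injOn_sweepA_posCell`) but `Ψ₂ = (b, B)` NOT (`B(1/4,3/16) = B(3/4,3/16) = 3/32`): a
  sign-CAD cell fed to the engine without the monotone refinement breaks it. With the refinement
  (split at `a = ½`) horizontal slices are intervals and the line's argument goes through.
* §8 NO SINGLE TWIST (the card's headline): `not_twistRestoresInjectivity` — for the typed cusp
  datum `S = (b−a)√|b−a|` no `λ : ℚ` makes `(a, A + λb)` injective on the open triangle
  (`exists_ne_cuspFibre_eq`); one `λ` works iff the twist is one-side bounded — do not re-introduce
  "one λ, no subdivision" for the Green generator as typed.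
So the line is sound where it is delicate; what remains is Lean labour (CAD, IFT, T–S images).
Landed (cycle 2): `Negative/EngineClosedness.lean`, `Negative/EngineInjectivity.lean`,
`Negative/SignCell.lean`, `Negative/TwistCusp.lean` (proposal ids in NOTES / item evidence; gate
outage from 03:05Z delayed filing). Imports: the route file + `SemialgebraicMapsProofs` (for §8's
`sqrt_holds` / `mul_holds`).

## Verdict (cycle 1): NO KILL — and no kill is *available to a refuter* for this item as typed.

`PlanarCompiler ↔ (RealOnePeriodRelations → PlanarK0Injective)` is `Iff.rfl`
(`planarCompiler_iff`): the crux is the GLUE 10042 → 9847. Hence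
`¬ PlanarCompiler ↔ RealOnePeriodRelations ∧ ¬ PlanarK0Injective`: a refutation must PROVE
Huber–Wüstholz-in-real-clothes (stmt-10042, XL, Wüstholz's analytic subgroup theorem) and REFUTE
curved ℚ̄-Bolyai–Gerwien (stmt-9847, open-problem). The two cheap kill channels are closed:

* (K1) antecedent FALSE ⇒ crux vacuously true. Not available: every generator of the antecedent's
  closure is eval-sound — 1a/1b/2 by the tree facts `KZ.eval_eq_zero_of_mem_*_holds`, the Green
  generator on paper (∇S = (A, B) continuous and bounded on the open triangle ⇒ S Lipschitz, extends
  to the closed triangle, edge-wise FTC + uniform continuity ⇒ ∮_{∂Δ}(A da + B db) = 0); and no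
  invariant of 1-dimensional representations killing 1a, 1b, 2, Green other than `eval` is in
  sight (germ/cusp-exponent and curve-type invariants die under endpoint-singular substitutions
  `x ↦ x^k` and under 1b). The grading of `FreeAbelianGroup` by dimension makes instances of
  1a/1b/2 in dimensions ≠ 1 irrelevant to the antecedent (project to the degree-1 component).
  §4 records the one TIGHTNESS fact found: continuity of `A, B` on the CLOSED triangle is
  load-bearing for soundness of the Green generator (angle form, period π/2).
* (K2) consequent FALSE outright ⇒ crux ⇔ ¬antecedent. Not available: an additive invariant of
  planar ℚ-regions under null-set removal, a.e.-disjoint union and ℚ-semialgebraic |det| = 1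
  injections, finer than area, is unknown (CressonViusos2022 Rem. 2.3; for POLYGONS over any
  subfield K ⊆ ℝ the equi-affine group SL₂(K) ⋉ K² already makes area the only scissors invariant —
  any two K-triangles of equal area are SA₂(K)-congruent — so a "curved Dehn invariant" would have
  to be transcendental-arithmetic, i.e. exactly what Huber–Wüstholz excludes); every topological
  candidate dies because null semialgebraic curves may be removed (§2.1 shows they MUST be).
  Junk channels checked and closed: off-domain integrand values (rule 2 with `Φ = id`), null hairs
  and isolated points (`[N] ≡ 0`, §3), non-uniqueness of `HasFDerivWithinAt` (only on null parts),
  unbounded / cusped finite-area regions (tamed by `(x,u) ↦ (1/x, ux²)`, `(t,y) ↦ (√t, 2√t·y)`,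
  |det| = 1), `IntegralRep` proof-irrelevance.

So in truth value the item ≡ `PlanarK0Injective` (9847); its difficulty label `L` describes the
compiler Θ only. What this file adds for the PROVERS is the load-bearing / strengthening analysis
of the consequent, all as Lean theorems, plus bookkeeping templates.

## Index (all sorry-free)
* §0 `PlanarOne`, `planarChainGroup` (= the conclusion subgroup `G`), `planarK0Injective_iff`,
  `planarCompiler_iff` (both `Iff.rfl`), `planarChainGroup_le_span` (G ≤ span PlanarOne),
  `planarChainGroup_le_ker_eval` (soundness), witness kit (`box`, `boxRep`, `emptyRep`,
  `unitSquare`, `farSquare`, values).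
* §1 LOAD-BEARING (consequent; for the implication each gives
  `(RealOnePeriodRelations → PlanarK0InjectiveWithout<H>) ↔ ¬ RealOnePeriodRelations`, i.e. a proof
  of the compiler not using `H` would refute HW-in-real-clothes):
  - `not_planarK0InjectiveWithoutValueEq` (+ `planarCompilerWithoutValueEq_iff`);
  - `not_planarK0InjectiveAE` (+ `planarCompilerAE_iff`): the pointwise hypothesis
    `∀ p ∈ r.domain, r.integrand p = 1` is used SYNTACTICALLY — `G` cannot mention a representation
    whose integrand is `1` only a.e. (`coeffHom`, `bumpSquare`); Θ must output honest sets.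
* §2 STRENGTHENINGS refuted:
  - `not_planarOneMove`: ONE global rule-2 instance (Monge form WITHOUT discarding null sets) is
    false — `(0,1)²` vs two far half-squares; `HasFDerivWithinAt` on an open domain ⇒ continuity ⇒
    preconnected image (`KZof_sub_KZof_inj` does the free-group bookkeeping). The dimension-2 face
    of barrier `cressonViuSos_prop_3_2` (vacuous there) is thus replaced by plain connectedness:
    keep the dissection / the null-set clause of `PlanarTransport`, `PlanarSAZylev`.
  - `not_planarCutsOnly`: rule 2 dropped ⇒ false (window functional `windowHom`, finite on every
    1a instance of every integrand and dimension).
* §3 POSITIVE templates: `of_mem_planarChainGroup_of_null`, `sub_mem_planarChainGroup_of_cov`,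
  `sub_mem_planarChainGroup_of_cut`, `sub_mem_cov_of_domain_eq` / `sub_mem_planarChainGroup_of_domain_eq`
  (off-domain junk is harmless: same domain ⇒ ONE rule-2 instance `Φ = id`); §3.1 NON-VACUITY `cruxHypotheses_satisfiable_nontrivially`
  via the worked planar rule-2 instance `unitSquare_sub_wideRect_mem_cov` (`diag(2, ½)`:
  semialgebraicity by `isSemialgebraicMapOn_aeval`, derivative of a CLM, injectivity, image, det).
* §4 ANTECEDENT AUDIT (tightness of the inlined Green generator): `greenRelaxed_unsound` — with
  continuity of `A, B` required only off the vertex `0` (everything else as typed, edges still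
  integrable), the generator contains the angle form `A = −b/(a²+b²)`, `B = a/(a²+b²)`,
  `S = arctan(b/a)` with `eval = π/2 > 0`. So CurvePeriodsTransfer must deliver `A, B` continuous
  up to the closed triangle (no residues at vertices), and the compiler only ever meets bounded
  continuous data — good news for Θ. §4.2 `greenLeftSignSlip_unsound`, `greenHypotenuseSlip_unsound`
  (+ `green_typed_db_sound`): the typed orientation of the three edge terms is the unique sound one
  (both natural slips fail on `η = db`).
* §5 THE FOLD IS REAL: `not_naiveGreenBands` — for the POLYNOMIAL Green datum `S = (a² − a)b`
  (`A = (2a−1)b`, `B = a² − a`, twist `2a − 1` changes sign) the band of vertical traces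
  `Ω₁ = {y between A(a,0), A(a,1−a)}` has area `1/4` and the band of horizontal traces
  `Ω₂ = {w between B(0,b), B(1−b,b)}` has area `1/6` (exact: `volume_bandOne`, `volume_bandTwo`), so
  they are not even KZ-equivalent; the signed identity holds (`fold_signed_identity`, both `−1/6`).
  Hence the plan's "subdivide Δ by the sign of ∂_bA" (or a twist-restoring shear / signed
  multiplicities, cf. the round-1 idea cards) is NECESSARY, not cosmetic: a stub realising Green
  by transporting the two unsigned trace bands is false. Smallest fold test datum for any line.
* §6 (cycle 2) ENGINE LOAD-BEARING: `ShearedTransportWithoutClosed/Inj₂/Inj₁` (the registered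
  `stub_shearedTransport` with one hypothesis deleted, verbatim otherwise, `lam : ℚ` kept) and
  `not_…` for each; kit: `value_eq_of_sub_mem_cov`, the double wedge `doubleWedgeRep` (value 2),
  slit boxes `slitA/slitB`, data `twoMul/sqFst/sqSnd` with their `fderiv`s, four image lemmas.
* §7 (cycle 2) SIGN CELL: `hump`, `cellS/cellA/cellB`, `twist` (+ `hasFDerivAt_cellS`,
  `fderiv_cellA_e1 = fderiv_cellB_e0 = twist`), `posCell` (open band over `(½−√3/6, ½+√3/6)` between
  `β` and the hypotenuse; `⊆` open triangle, twist `> 0` on it, bottom = zero-twist curve),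
  `injOn_sweepA_posCell`, `not_injOn_sweepB_posCell`, `PosTwistBandSweepInjective` + `not_…`.
* §8 (cycle 2) TWIST CUSP: `cuspPhi` (+ `hasDerivAt_cuspPhi` at the cusp), `cuspS/cuspA/cuspB`
  (`hasFDerivAt_cuspS`, semialgebraic via `abs`/`sqrt_holds`/`mul_holds`), `cuspFibre`,
  `cusp_beats_linear`, `exists_ne_cuspFibre_eq`, `TwistRestoresInjectivity` + `not_…`.
* TORSION (paper, closes an open question of cycle 0): `M₁/R₁⁺` (1-dim reps modulo the antecedent's
  generators) is a `(ℚ̄ ∩ ℝ)`-VECTOR SPACE — integrand scaling `α·[∫_σ f] := [∫_σ αf]` is additive in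
  `α` by 1b and preserves every generator family — hence torsion-free; so the complex-scalar step of
  the HW transport (`Θ` into `(M₁/R₁⁺) ⊗ ℚ̄`) loses nothing, and no torsion obstruction to the
  antecedent exists.

## Landed homes (cite the TREE versions; this work file keeps self-contained copies)
The SIBLING crux's refuter (cdisprove on stmt-9847) landed, independently and first,
`Theorems/PlanarK0Injective/Negative/{Kit,LoadBearing,OneMove}.lean` (namespace
`Summit.KontsevichZagierPeriods.SymplecticScissors.PlanarK0InjectiveNegative`): `planarGens`,
`planarGroup` (= `PlanarOne`, `planarChainGroup` here), `eval_eq_zero_of_mem_planarGroup`, box kit,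
`eq_of_of_sub_of_eq` (= `KZof_sub_KZof_inj`), `of_mem_planarGroup_of_volume_eq_zero`,
`of_sub_of_mem_planarGroup_of_domain_eq`, `planarK0Injective_false_without_value_eq`,
`planarK0Injective_false_without_integrand_one` (planarDefect), `not_planarScissorsOnly`
(= `not_planarCutsOnly`), `not_planarOneMove` / `not_planarOneMoveOpen` (= §2.1), hypDilation
`diag(2,½)` calibration (= §3.1). So §0–§3 of this file are CONFIRMATIONS, landed there; the
PlanarCompiler-specific material lands under `Theorems/PlanarCompiler/Negative/`:
`GreenTightness.lean` (§4, p73140 ACCEPTED), `Implication.lean` (planarCompiler_iff,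
compilerWithout_iff_not_antecedent, the a.e. sharpening `not_planarK0InjectiveAE`; p74703 ACCEPTED),
`GreenOrientation.lean` (§4.2, p75007 ACCEPTED), `Fold.lean` (§5, p75530 ACCEPTED) — rebased on the sibling
kit. ALL FOUR LANDED (cycle 1).

## For provers / planners (briefing)
(cycle 2) Line twist-restoring-shear: keep BOTH injectivity hypotheses of the engine and the
closedness hypothesis (§6: each is necessary); in `stub_signedSweep` the MONOTONICITY of the graph
functions `lo, hi` on each strip is what makes `Ψ₂` injective on a signed cell (§7: without it a
twist-positive cell folds horizontally) — refine the sign-CAD at the turning points of every graph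
function; `Ψ₁`-injectivity is inherited by sub-cells, so refining never hurts. Smallest test data:
fold `S = (a²−a)b` (§5), wedge `S = a²b` (§6), hump `S = a³b − (3/2)a²b + ab²/2 + ab/2` (§7).
No restatement needed. Prove 9852/9853/9854 first; define Θ by `FreeAbelianGroup.lift` on
`Σ n, IntegralRep n`, zero off `n = 1` (grading kills cross-dimension instances); Θ's values must be
literal integrand-1 reps (§1); never aim at a one-move normal form (§2.1); null sets are free (§3).
The previous crux-attack evidence (refuter rattack, 2026-08-15: `Evidence.lean`,
`CruxAttack-10058.md` on the item) covers read-back, `planarK0Injective_of_value_eq_zero` (the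
value-0 layer is TRUE) and `of_piRep_not_mem`; this file does not repeat those.
-/

noncomputable section

set_option linter.dupNamespace false

open MeasureTheory Set MvPolynomial Filter Topology
open Literature.NumberTheory.Transcendental Literature.ModelTheory.ExponentialFields
open Summit.KontsevichZagierPeriods.KontsevichZagierPeriods.Theses.SymplecticScissors

namespace Summit.KontsevichZagierPeriods.KontsevichZagierPeriods.Cruxes.PlanarCompiler.Disproof

/-! ## §0 Vocabulary: the planar set-chain group -/

/-- The generators `[s]` of the planar sector: planar representations with integrand `1` on the
domain (pointwise). -/
def PlanarOne : Set KZ.FormalRep :=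
  {x | ∃ s : KZ.IntegralRep 2, (∀ p ∈ s.domain, s.integrand p = 1) ∧ x = KZ.of s}

/-- The planar set-chain group `G` of the route (conclusion of `PlanarK0Injective`,
`PlanarCompiler`, `TransportToGroup`, `StackingShear`; hypothesis of `PlanarSAZylev`, `GroupToAreas`):
generated by the instances of rule 1a and rule 2 that are supported on `PlanarOne`. -/
def planarChainGroup : AddSubgroup KZ.FormalRep :=
  AddSubgroup.closure ((KZ.domainAddRel ∪ KZ.changeOfVariablesRel) ∩
    (AddSubgroup.closure PlanarOne : Set KZ.FormalRep))

/-- `PlanarK0Injective` read through the vocabulary (definitional). -/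
theorem planarK0Injective_iff :
    PlanarK0Injective ↔ ∀ r r' : KZ.IntegralRep 2, (∀ p ∈ r.domain, r.integrand p = 1) →
      (∀ p ∈ r'.domain, r'.integrand p = 1) → r.value = r'.value →
      KZ.of r - KZ.of r' ∈ planarChainGroup :=
  Iff.rfl

/-- `PlanarCompiler` is literally `RealOnePeriodRelations → PlanarK0Injective` (definitional). -/
theorem planarCompiler_iff : PlanarCompiler ↔ (RealOnePeriodRelations → PlanarK0Injective) :=
  Iff.rfl

/-- `G` lives inside the span of the planar integrand-1 generators. -/
theorem planarChainGroup_le_span : planarChainGroup ≤ AddSubgroup.closure PlanarOne :=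
  (AddSubgroup.closure_le _).mpr fun _ hx => hx.2

/-- `G` is sound: every planar set-chain evaluates to `0` (rules 1a and 2 are sound, tree facts
`KZ.eval_eq_zero_of_mem_domainAddRel_holds`, `KZ.eval_eq_zero_of_mem_changeOfVariablesRel_holds`). -/
theorem planarChainGroup_le_ker_eval : planarChainGroup ≤ KZ.eval.ker := by
  refine (AddSubgroup.closure_le _).mpr ?_
  rintro c ⟨hc | hc, -⟩
  · exact (AddMonoidHom.mem_ker).2 (KZ.eval_eq_zero_of_mem_domainAddRel_holds hc)
  · exact (AddMonoidHom.mem_ker).2 (KZ.eval_eq_zero_of_mem_changeOfVariablesRel_holds hc)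

theorem value_eq_of_sub_mem_planarChainGroup {r r' : KZ.IntegralRep 2}
    (h : KZ.of r - KZ.of r' ∈ planarChainGroup) : r.value = r'.value := by
  have := planarChainGroup_le_ker_eval h
  rwa [AddMonoidHom.mem_ker, map_sub, KZ.eval_of, KZ.eval_of, sub_eq_zero] at this

/-! ## §0' Witness kit: rational boxes and the empty representation in the plane -/

/-- Open coordinate box `(l₀,u₀) × (l₁,u₁) ⊆ ℝ²` with rational corners. -/
def box (l u : Fin 2 → ℚ) : Set (Fin 2 → ℝ) :=
  Set.pi univ fun i => Ioo (l i : ℝ) (u i)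

theorem mem_box {l u : Fin 2 → ℚ} {p : Fin 2 → ℝ} :
    p ∈ box l u ↔ ∀ i, (l i : ℝ) < p i ∧ p i < u i := by
  simp [box]

theorem pi_univ_eq_biInter (S : Fin 2 → Set ℝ) :
    Set.pi univ S = ⋂ i ∈ (Finset.univ : Finset (Fin 2)), {p : Fin 2 → ℝ | p i ∈ S i} := by
  ext p; simp

theorem isSemialgebraic_coord_Ioo (i : Fin 2) (l u : ℚ) :
    IsSemialgebraic ℚ {p : Fin 2 → ℝ | p i ∈ Ioo (l : ℝ) u} := by
  have h := (isSemialgebraic_setOf_eval_lt (k := ℚ) (R := ℝ) (ι := Fin 2) (C l) (X i)).inter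
    (isSemialgebraic_setOf_eval_lt (k := ℚ) (R := ℝ) (ι := Fin 2) (X i) (C u))
  have hEq : {p : Fin 2 → ℝ | p i ∈ Ioo (l : ℝ) u} =
      {x : Fin 2 → ℝ | aeval x (C l : MvPolynomial (Fin 2) ℚ) < aeval x (X i : MvPolynomial (Fin 2) ℚ)} ∩
      {x : Fin 2 → ℝ | aeval x (X i : MvPolynomial (Fin 2) ℚ) < aeval x (C u : MvPolynomial (Fin 2) ℚ)} := by
    ext p; simp
  rw [hEq]; exact h

/-- Rational boxes are `ℚ`-semialgebraic. -/
theorem isSemialgebraic_box (l u : Fin 2 → ℚ) : IsSemialgebraic ℚ (box l u) := by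
  rw [box, pi_univ_eq_biInter]
  exact IsSemialgebraic.biInter _ _ fun i _ => isSemialgebraic_coord_Ioo i (l i) (u i)

theorem volume_box (l u : Fin 2 → ℚ) :
    volume (box l u) = ∏ i, ENNReal.ofReal ((u i : ℝ) - l i) := by
  simp [box, Real.volume_pi_Ioo]

theorem volume_box_lt_top (l u : Fin 2 → ℚ) : volume (box l u) < ⊤ := by
  rw [volume_box]
  exact ENNReal.prod_lt_top fun _ _ => ENNReal.ofReal_lt_top

/-- The constant function `1` is a `ℚ`-semialgebraic function on any `ℚ`-semialgebraic set. -/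
theorem isSemialgebraicFunOn_one {n : ℕ} {s : Set (Fin n → ℝ)} (hs : IsSemialgebraic ℚ s) :
    IsSemialgebraicFunOn ℚ s (fun _ => (1 : ℝ)) := by
  simpa using isSemialgebraicFunOn_aeval hs (C 1 : MvPolynomial (Fin n) ℚ)

/-- `[box l u, 1]`: the planar set `box l u` as an integrand-1 representation. -/
def boxRep (l u : Fin 2 → ℚ) : KZ.IntegralRep 2 where
  domain := box l u
  integrand := fun _ => 1
  isSemialgebraic_domain := isSemialgebraic_box l u
  isSemialgebraicFunOn_integrand := isSemialgebraicFunOn_one (isSemialgebraic_box l u)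
  integrableOn := integrableOn_const (volume_box_lt_top l u).ne

@[simp] theorem boxRep_domain (l u : Fin 2 → ℚ) : (boxRep l u).domain = box l u := rfl
@[simp] theorem boxRep_integrand (l u : Fin 2 → ℚ) : (boxRep l u).integrand = fun _ => 1 := rfl

theorem boxRep_mem_planarOne (l u : Fin 2 → ℚ) : KZ.of (boxRep l u) ∈ PlanarOne :=
  ⟨boxRep l u, fun _ _ => rfl, rfl⟩

theorem volume_box_toReal {l u : Fin 2 → ℚ} (h : ∀ i, l i ≤ u i) :
    (volume (box l u)).toReal = ∏ i, ((u i : ℝ) - l i) := by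
  rw [box, Real.volume_pi_Ioo_toReal]
  exact fun i => by dsimp only; exact_mod_cast h i

theorem measurableSet_box (l u : Fin 2 → ℚ) : MeasurableSet (box l u) :=
  MeasurableSet.univ_pi fun _ => measurableSet_Ioo

/-- The value of an integrand-1 representation is the area of its domain. -/
theorem value_of_integrand_one (r : KZ.IntegralRep 2) (hr : r.integrand = fun _ => 1) :
    r.value = (volume r.domain).toReal := by
  rw [KZ.IntegralRep.value, hr, setIntegral_const, smul_eq_mul, mul_one, measureReal_def]

theorem value_boxRep {l u : Fin 2 → ℚ} (h : ∀ i, l i ≤ u i) :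
    (boxRep l u).value = ∏ i, ((u i : ℝ) - l i) := by
  rw [value_of_integrand_one _ rfl, boxRep_domain, volume_box_toReal h]

/-- The empty planar representation (value `0`). -/
def emptyRep : KZ.IntegralRep 2 where
  domain := ∅
  integrand := fun _ => 1
  isSemialgebraic_domain := isSemialgebraic_empty
  isSemialgebraicFunOn_integrand := isSemialgebraicFunOn_one isSemialgebraic_empty
  integrableOn := integrableOn_empty

@[simp] theorem emptyRep_domain : emptyRep.domain = ∅ := rfl
@[simp] theorem value_emptyRep : emptyRep.value = 0 := by
  simp [KZ.IntegralRep.value]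

theorem emptyRep_mem_planarOne : KZ.of emptyRep ∈ PlanarOne := ⟨emptyRep, fun _ h => h.elim, rfl⟩

/-- The unit square `(0,1)²` and its far translate `(2,3) × (0,1)`. -/
def unitSquare : KZ.IntegralRep 2 := boxRep ![0, 0] ![1, 1]
def farSquare : KZ.IntegralRep 2 := boxRep ![2, 0] ![3, 1]

theorem value_unitSquare : unitSquare.value = 1 := by
  rw [unitSquare, value_boxRep] <;> simp [Fin.forall_fin_two]
theorem value_farSquare : farSquare.value = 1 := by
  rw [farSquare, value_boxRep] <;> norm_num [Fin.forall_fin_two]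


/-! ## §1 LOAD-BEARING ANALYSIS of the consequent `PlanarK0Injective`

`PlanarCompiler` is the implication `RealOnePeriodRelations → PlanarK0Injective`; its antecedent
is Huber–Wüstholz in real clothes (stmt-10042, XL), so `¬ PlanarCompiler ↔ RealOnePeriodRelations ∧
¬ PlanarK0Injective` is out of reach of a refuter *by construction*, and so is every
hypothesis-dropped variant of the implication. What CAN be decided is the consequent: for each
hypothesis `H` of `PlanarK0Injective` we prove `¬ PlanarK0InjectiveWithout<H>`, and hence
(`imp_false_iff_not`) that the hypothesis-dropped compiler is *equivalent to a disproof of the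
antecedent*: any proof strategy for `PlanarCompiler` that does not use `H` would refute
Huber–Wüstholz-in-real-clothes. -/

/-- A hypothesis-dropped compiler is exactly as strong as the negation of the antecedent. -/
theorem compilerWithout_iff_not_antecedent {B : Prop} (hB : ¬ B) :
    (RealOnePeriodRelations → B) ↔ ¬ RealOnePeriodRelations :=
  ⟨fun h hA => hB (h hA), fun h hA => (h hA).elim⟩

/-- `PlanarK0Injective` with the hypothesis `r.value = r'.value` dropped. -/
def PlanarK0InjectiveWithoutValueEq : Prop :=
  ∀ r r' : KZ.IntegralRep 2, (∀ p ∈ r.domain, r.integrand p = 1) →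
    (∀ p ∈ r'.domain, r'.integrand p = 1) → KZ.of r - KZ.of r' ∈ planarChainGroup

/-- LOAD-BEARING (value): without `r.value = r'.value` the consequent is false — the planar
set-chain group is sound (`planarChainGroup_le_ker_eval`); witness `∅` versus `(0,1)²`. -/
theorem not_planarK0InjectiveWithoutValueEq : ¬ PlanarK0InjectiveWithoutValueEq := by
  intro h
  have h0 := value_eq_of_sub_mem_planarChainGroup
    (h emptyRep unitSquare (fun _ hp => hp.elim) (fun _ _ => rfl))
  rw [value_emptyRep, value_unitSquare] at h0
  exact zero_ne_one h0

theorem planarCompilerWithoutValueEq_iff :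
    (RealOnePeriodRelations → PlanarK0InjectiveWithoutValueEq) ↔ ¬ RealOnePeriodRelations :=
  compilerWithout_iff_not_antecedent not_planarK0InjectiveWithoutValueEq

/-! ### The integrand-1 hypothesis is used *syntactically*

`G ≤ span PlanarOne` (`planarChainGroup_le_span`): the conclusion cannot even *mention* a
representation whose integrand is not literally `1` at every point of its domain. So the
pointwise hypothesis `∀ p ∈ r.domain, r.integrand p = 1` cannot be weakened to "almost
everywhere" (nor to `r.value = volume r.domain`): the compiler's realisation map `Θ` must output
chains of honest sets. Witness: the unit square with integrand `2` at its centre only. -/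

open Classical in
/-- The support functional `χₐ : FormalRep →+ ℤ`, coefficient of the generator `a`. -/
def coeffHom (a : Σ n, KZ.IntegralRep n) : KZ.FormalRep →+ ℤ :=
  FreeAbelianGroup.lift fun x => if x = a then 1 else 0

open Classical in
@[simp] theorem coeffHom_of (a b : Σ n, KZ.IntegralRep n) :
    coeffHom a (FreeAbelianGroup.of b) = if b = a then 1 else 0 := by
  simp [coeffHom]

open Classical in
theorem coeffHom_KZof {n : ℕ} (a : Σ n, KZ.IntegralRep n) (s : KZ.IntegralRep n) :
    coeffHom a (KZ.of s) = if (⟨n, s⟩ : Σ n, KZ.IntegralRep n) = a then 1 else 0 :=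
  coeffHom_of a ⟨n, s⟩

/-- If `r` is not an integrand-1 representation, its coefficient functional kills `span PlanarOne`,
hence `G`. -/
theorem coeffHom_eq_zero_of_mem_span {r : KZ.IntegralRep 2}
    (hr : ¬ ∀ p ∈ r.domain, r.integrand p = 1) {c : KZ.FormalRep}
    (hc : c ∈ AddSubgroup.closure PlanarOne) : coeffHom ⟨2, r⟩ c = 0 := by
  refine (AddSubgroup.closure_le (K := (coeffHom ⟨2, r⟩).ker)).mpr ?_ hc
  rintro _ ⟨s, hs, rfl⟩
  simp only [SetLike.mem_coe, AddMonoidHom.mem_ker, coeffHom_KZof]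
  split_ifs with h
  · cases h
    exact (hr hs).elim
  · rfl

/-- The unit square with integrand `2` at the centre and `1` elsewhere: value `1`, but NOT an
element of `PlanarOne`. -/
def centre : Fin 2 → ℝ := fun _ => 1 / 2

theorem centre_mem_box : centre ∈ box ![0, 0] ![1, 1] := by
  rw [mem_box]; intro i; fin_cases i <;> norm_num [centre]

theorem isSemialgebraic_singleton_centre : IsSemialgebraic ℚ ({centre} : Set (Fin 2 → ℝ)) := by
  have h := (isSemialgebraic_setOf_eval_eq_zero (k := ℚ) (R := ℝ) (ι := Fin 2)
    (X 0 - C (1 / 2))).inter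
    (isSemialgebraic_setOf_eval_eq_zero (k := ℚ) (R := ℝ) (ι := Fin 2) (X 1 - C (1 / 2)))
  have hEq : ({centre} : Set (Fin 2 → ℝ)) =
      {x : Fin 2 → ℝ | aeval x (X 0 - C (1 / 2) : MvPolynomial (Fin 2) ℚ) = 0} ∩
      {x : Fin 2 → ℝ | aeval x (X 1 - C (1 / 2) : MvPolynomial (Fin 2) ℚ) = 0} := by
    ext p
    simp only [mem_singleton_iff, mem_inter_iff, mem_setOf_eq, map_sub, aeval_X, aeval_C,
      sub_eq_zero, eq_ratCast]
    constructor
    · rintro rfl; norm_num [centre]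
    · rintro ⟨h0, h1⟩
      ext i; fin_cases i
      · simpa [centre] using h0
      · simpa [centre] using h1
  rw [hEq]; exact h

/-- The bumped integrand: `2` at the centre, `1` elsewhere. -/
def bump : (Fin 2 → ℝ) → ℝ := fun p => if p = centre then 2 else 1

theorem isSemialgebraicFunOn_bump : IsSemialgebraicFunOn ℚ (box ![0, 0] ![1, 1]) bump := by
  classical
  -- graph over the box = graph of `1` over `box \ {centre}` ∪ graph of `2` over `{centre}`
  have h1 : IsSemialgebraicFunOn ℚ (box ![0, 0] ![1, 1] \ {centre}) bump := by
    refine (isSemialgebraicFunOn_aeval ((isSemialgebraic_box _ _).diff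
      isSemialgebraic_singleton_centre) (C 1 : MvPolynomial (Fin 2) ℚ)).congr ?_
    intro p hp
    have : p ≠ centre := fun h => hp.2 (by simp [h])
    simp [bump, this]
  have h2 : IsSemialgebraicFunOn ℚ ({centre} : Set (Fin 2 → ℝ)) bump := by
    refine (isSemialgebraicFunOn_aeval isSemialgebraic_singleton_centre
      (C 2 : MvPolynomial (Fin 2) ℚ)).congr ?_
    intro p hp
    rw [mem_singleton_iff] at hp
    simp [bump, hp]
  unfold IsSemialgebraicFunOn at h1 h2 ⊢
  convert h1.union h2 using 1
  ext z
  simp only [mem_setOf_eq, mem_union]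
  constructor
  · rintro ⟨x, hx, rfl⟩
    by_cases hxc : x = centre
    · exact Or.inr ⟨x, hxc, rfl⟩
    · exact Or.inl ⟨x, ⟨hx, hxc⟩, rfl⟩
  · rintro (⟨x, ⟨hx, -⟩, rfl⟩ | ⟨x, rfl, rfl⟩)
    · exact ⟨x, hx, rfl⟩
    · exact ⟨centre, centre_mem_box, rfl⟩

theorem bump_ae_eq_one : bump =ᵐ[volume.restrict (box ![0, 0] ![1, 1])] fun _ => 1 := by
  have hnull : volume ({centre} : Set (Fin 2 → ℝ)) = 0 := measure_singleton centre
  have : ∀ᵐ p ∂(volume : Measure (Fin 2 → ℝ)), p ≠ centre := by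
    rw [ae_iff]; simp [hnull]
  refine ae_restrict_of_ae ?_
  filter_upwards [this] with p hp
  simp [bump, hp]

/-- `[(0,1)², bump]`: a planar representation of value `1` whose integrand is `1` only a.e. -/
def bumpSquare : KZ.IntegralRep 2 where
  domain := box ![0, 0] ![1, 1]
  integrand := bump
  isSemialgebraic_domain := isSemialgebraic_box _ _
  isSemialgebraicFunOn_integrand := isSemialgebraicFunOn_bump
  integrableOn := (integrableOn_const (volume_box_lt_top _ _).ne).congr_fun_ae bump_ae_eq_one.symm

theorem value_bumpSquare : bumpSquare.value = 1 := by
  have : bumpSquare.value = unitSquare.value := by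
    simp only [KZ.IntegralRep.value]
    exact integral_congr_ae bump_ae_eq_one
  rw [this, value_unitSquare]

theorem bumpSquare_not_planarOne : ¬ ∀ p ∈ bumpSquare.domain, bumpSquare.integrand p = 1 := by
  intro h
  have := h centre centre_mem_box
  norm_num [bumpSquare, bump] at this

theorem bumpSquare_ae_one : ∀ᵐ p ∂(volume.restrict bumpSquare.domain), bumpSquare.integrand p = 1 :=
  bump_ae_eq_one

/-- `PlanarK0Injective` with the pointwise integrand hypothesis on `r` weakened to "a.e.". -/
def PlanarK0InjectiveAE : Prop :=
  ∀ r r' : KZ.IntegralRep 2, (∀ᵐ p ∂(volume.restrict r.domain), r.integrand p = 1) →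
    (∀ p ∈ r'.domain, r'.integrand p = 1) → r.value = r'.value →
    KZ.of r - KZ.of r' ∈ planarChainGroup

/-- LOAD-BEARING (pointwise integrand `1`, syntactic): the a.e. weakening is false — `G` cannot
see `bumpSquare` at all (`coeffHom` kills `span PlanarOne ⊇ G` but not `[bumpSquare] − [unitSquare]`). -/
theorem not_planarK0InjectiveAE : ¬ PlanarK0InjectiveAE := by
  intro h
  have hmem := planarChainGroup_le_span
    (h bumpSquare unitSquare bumpSquare_ae_one (fun _ _ => rfl)
      (value_bumpSquare.trans value_unitSquare.symm))
  have h0 := coeffHom_eq_zero_of_mem_span bumpSquare_not_planarOne hmem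
  rw [map_sub, coeffHom_KZof, coeffHom_KZof, if_pos rfl, if_neg] at h0
  · norm_num at h0
  · intro hEq
    have hru : unitSquare = bumpSquare := eq_of_heq (Sigma.mk.inj_iff.mp hEq).2
    exact bumpSquare_not_planarOne (hru ▸ fun _ _ => rfl)

theorem planarCompilerAE_iff :
    (RealOnePeriodRelations → PlanarK0InjectiveAE) ↔ ¬ RealOnePeriodRelations :=
  compilerWithout_iff_not_antecedent not_planarK0InjectiveAE


/-! ## §2 NATURAL STRENGTHENINGS of the consequent, refuted

### §2.1 One global move (Monge form without null sets) — false by connectedness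

`changeOfVariablesRel` asks `HasFDerivWithinAt Φ (Φ' x) r.domain x` on the whole domain; on an
OPEN domain this makes `Φ` continuous, so `Φ '' r.domain` is (pre)connected whenever `r.domain`
is. Hence ONE move cannot carry the unit square onto two far-apart half-squares of the same total
area: the null cut locus must be DISCARDED first (the `s ⊆ r`, `volume (r ∖ s) = 0` clause of
`PlanarTransport` / `PlanarSAZylev`), or the statement must be the chain/K₀ form. Any invariant
finer than area must therefore survive removal of null semialgebraic curves — which kills every
topological candidate (components, Euler characteristic, boundary germs). -/

/-- Support bookkeeping in the free abelian group: `[a] − [b] = [c] − [d]` with `a ≠ b` forces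
`a = c` and `b = d` (as generators of `FormalRep`). -/
theorem KZof_sub_KZof_inj {n m : ℕ} {a b : KZ.IntegralRep n} {c d : KZ.IntegralRep m}
    (hab : a ≠ b) (h : KZ.of a - KZ.of b = KZ.of c - KZ.of d) :
    (⟨n, a⟩ : Σ k, KZ.IntegralRep k) = ⟨m, c⟩ ∧ (⟨n, b⟩ : Σ k, KZ.IntegralRep k) = ⟨m, d⟩ := by
  have hab' : (⟨n, a⟩ : Σ k, KZ.IntegralRep k) ≠ ⟨n, b⟩ := fun h' =>
    hab (eq_of_heq (Sigma.mk.inj_iff.mp h').2)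
  by_cases hca : (⟨m, c⟩ : Σ k, KZ.IntegralRep k) = ⟨n, a⟩
  · by_cases hdb : (⟨m, d⟩ : Σ k, KZ.IntegralRep k) = ⟨n, b⟩
    · exact ⟨hca.symm, hdb.symm⟩
    · exfalso
      have hb := congrArg (coeffHom ⟨n, b⟩) h
      have hcb : ¬ (⟨m, c⟩ : Σ k, KZ.IntegralRep k) = ⟨n, b⟩ := fun h' => hab' (hca.symm.trans h')
      simp only [map_sub, coeffHom_KZof, if_neg hab', if_neg hcb, if_neg hdb] at hb
      norm_num at hb
  · exfalso
    have ha := congrArg (coeffHom ⟨n, a⟩) h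
    simp only [map_sub, coeffHom_KZof, if_neg hab'.symm, if_neg hca] at ha
    split_ifs at ha <;> norm_num at ha

/-- Two far-apart half-squares `(0,1) × (0,½) ∪ (2,3) × (0,½)` (total area `1`). -/
def halvesSet : Set (Fin 2 → ℝ) := box ![0, 0] ![1, 1 / 2] ∪ box ![2, 0] ![3, 1 / 2]

theorem isSemialgebraic_halvesSet : IsSemialgebraic ℚ halvesSet :=
  (isSemialgebraic_box _ _).union (isSemialgebraic_box _ _)

theorem volume_halvesSet_lt_top : volume halvesSet < ⊤ :=
  lt_of_le_of_lt (measure_union_le _ _)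
    (ENNReal.add_lt_top.2 ⟨volume_box_lt_top _ _, volume_box_lt_top _ _⟩)

/-- `[halvesSet, 1]`. -/
def twoHalves : KZ.IntegralRep 2 where
  domain := halvesSet
  integrand := fun _ => 1
  isSemialgebraic_domain := isSemialgebraic_halvesSet
  isSemialgebraicFunOn_integrand := isSemialgebraicFunOn_one isSemialgebraic_halvesSet
  integrableOn := integrableOn_const volume_halvesSet_lt_top.ne

theorem disjoint_halves : Disjoint (box ![0, 0] ![1, 1 / 2]) (box ![2, 0] ![3, 1 / 2]) := by
  rw [Set.disjoint_left]
  intro p hp hp'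
  have h1 := (mem_box.mp hp 0).2
  have h2 := (mem_box.mp hp' 0).1
  simp at h1 h2
  linarith

theorem value_twoHalves : twoHalves.value = 1 := by
  rw [value_of_integrand_one _ rfl, show twoHalves.domain = halvesSet from rfl, halvesSet,
    measure_union disjoint_halves (measurableSet_box _ _),
    ENNReal.toReal_add (volume_box_lt_top _ _).ne (volume_box_lt_top _ _).ne,
    volume_box_toReal (by intro i; fin_cases i <;> norm_num),
    volume_box_toReal (by intro i; fin_cases i <;> norm_num)]
  simp [Fin.prod_univ_two]
  norm_num

theorem isPreconnected_box (l u : Fin 2 → ℚ) : IsPreconnected (box l u) :=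
  (convex_pi fun i _ => convex_Ioo (l i : ℝ) (u i)).isPreconnected

/-- The far point `(5/2, 1/4)` of `halvesSet`. -/
def farPoint : Fin 2 → ℝ := ![5 / 2, 1 / 4]

theorem farPoint_mem : farPoint ∈ halvesSet :=
  Or.inr (by rw [mem_box]; intro i; fin_cases i <;> norm_num [farPoint])

theorem not_isPreconnected_halvesSet : ¬ IsPreconnected halvesSet := by
  intro h
  have hu : IsOpen {p : Fin 2 → ℝ | p 0 < 2} := isOpen_lt (continuous_apply 0) continuous_const
  have hv : IsOpen {p : Fin 2 → ℝ | 2 < p 0} := isOpen_lt continuous_const (continuous_apply 0)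
  have hdisj : Disjoint {p : Fin 2 → ℝ | p 0 < 2} {p : Fin 2 → ℝ | 2 < p 0} := by
    rw [Set.disjoint_left]
    intro p h1 h2
    simp only [mem_setOf_eq] at h1 h2
    linarith
  have hsub : halvesSet ⊆ {p : Fin 2 → ℝ | p 0 < 2} ∪ {p | 2 < p 0} := by
    rintro p (hp | hp)
    · have := (mem_box.mp hp 0).2
      simp at this
      exact Or.inl (show p 0 < 2 by linarith)
    · have := (mem_box.mp hp 0).1
      simp at this
      exact Or.inr (show 2 < p 0 by linarith)
  have ha : (![1 / 2, 1 / 4] : Fin 2 → ℝ) ∈ halvesSet :=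
    Or.inl (by rw [mem_box]; intro i; fin_cases i <;> norm_num)
  have hleft := h.subset_left_of_subset_union hu hv hdisj hsub
    ⟨![1 / 2, 1 / 4], ha, by norm_num⟩
  have := hleft farPoint_mem
  norm_num [farPoint] at this

theorem unitSquare_ne_twoHalves : unitSquare ≠ twoHalves := by
  intro h
  have hd : unitSquare.domain = twoHalves.domain := by rw [h]
  have hb : farPoint ∈ unitSquare.domain := hd ▸ farPoint_mem
  have := (mem_box.mp hb 0).2
  norm_num [farPoint] at this

/-- STRENGTHENING 1 (Monge form without null sets): ONE rule-2 instance between the two sets. -/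
def PlanarOneMove : Prop :=
  ∀ r r' : KZ.IntegralRep 2, (∀ p ∈ r.domain, r.integrand p = 1) →
    (∀ p ∈ r'.domain, r'.integrand p = 1) → r.value = r'.value →
    KZ.of r - KZ.of r' ∈ KZ.changeOfVariablesRel

/-- `PlanarOneMove` is FALSE: the unit square is connected, `halvesSet` is not, and a rule-2 map is
continuous on an open domain. (So the null-set clause of `PlanarTransport`/`PlanarSAZylev` is
load-bearing, and no topological invariant can refine area in the chain group.) -/
theorem not_planarOneMove : ¬ PlanarOneMove := by
  intro h
  obtain ⟨n, r₀, r₀', Φ, Φ', -, hderiv, -, himg, -, hEq⟩ :=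
    h unitSquare twoHalves (fun _ _ => rfl) (fun _ _ => rfl)
      (value_unitSquare.trans value_twoHalves.symm)
  obtain ⟨h1, h2⟩ := KZof_sub_KZof_inj unitSquare_ne_twoHalves hEq
  obtain ⟨hn, h1'⟩ := Sigma.mk.inj_iff.mp h1
  subst hn
  have hr₀ : unitSquare = r₀ := eq_of_heq h1'
  have hr₀' : twoHalves = r₀' := eq_of_heq (Sigma.mk.inj_iff.mp h2).2
  subst hr₀ hr₀'
  have hcont : ContinuousOn Φ unitSquare.domain := fun x hx => (hderiv x hx).continuousWithinAt
  have hpre : IsPreconnected (Φ '' unitSquare.domain) := (isPreconnected_box _ _).image Φ hcont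
  rw [← himg] at hpre
  exact not_isPreconnected_halvesSet hpre

/-! ### §2.2 Cuts only (rule 2 dropped) — false by a window functional

Dropping `changeOfVariablesRel` from `G` leaves the subgroup generated by rule 1a among planar
sets; the Lebesgue measure *inside a fixed window* is then invariant (finite even on
infinite-area domains of arbitrary-integrand instances), so a square is not equivalent to its
translate. Rule 2 is load-bearing (of course); recorded for completeness of the (a)-analysis. -/

/-- Window functional on generators: area of the part of a planar domain inside `(0,1)²`,
zero in other dimensions. -/
def windowMeasure : (Σ n, KZ.IntegralRep n) → ℝ
  | ⟨2, s⟩ => (volume (s.domain ∩ box ![0, 0] ![1, 1])).toReal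
  | _ => 0

/-- Its additive extension to `FormalRep`. -/
def windowHom : KZ.FormalRep →+ ℝ := FreeAbelianGroup.lift windowMeasure

theorem windowHom_of_two (s : KZ.IntegralRep 2) :
    windowHom (KZ.of s) = (volume (s.domain ∩ box ![0, 0] ![1, 1])).toReal := by
  simp [windowHom, KZ.of, windowMeasure]

theorem volume_inter_window_lt_top (t : Set (Fin 2 → ℝ)) :
    volume (t ∩ box ![0, 0] ![1, 1]) < ⊤ :=
  lt_of_le_of_lt (measure_mono inter_subset_right) (volume_box_lt_top _ _)

/-- Rule 1a (in every dimension, for every integrand) is killed by the window functional. -/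
theorem windowHom_eq_zero_of_mem_domainAddRel {c : KZ.FormalRep} (hc : c ∈ KZ.domainAddRel) :
    windowHom c = 0 := by
  obtain ⟨n, r, r₁, r₂, hdom, hnull, -, -, rfl⟩ := hc
  rcases n with _ | _ | _ | n
  · simp [windowHom, KZ.of, windowMeasure]
  · simp [windowHom, KZ.of, windowMeasure]
  · rw [map_sub, map_sub, windowHom_of_two, windowHom_of_two, windowHom_of_two, hdom,
      union_inter_distrib_right]
    have hsub : r₁.domain ∩ box ![0, 0] ![1, 1] ∩ (r₂.domain ∩ box ![0, 0] ![1, 1]) ⊆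
        r₁.domain ∩ r₂.domain := fun p hp => ⟨hp.1.1, hp.2.1⟩
    have hd : AEDisjoint volume (r₁.domain ∩ box ![0, 0] ![1, 1]) (r₂.domain ∩ box ![0, 0] ![1, 1]) :=
      measure_mono_null hsub hnull
    rw [measure_union₀ ((KZ.IntegralRep.measurableSet_domain_holds r₂).inter
      (measurableSet_box _ _)).nullMeasurableSet hd,
      ENNReal.toReal_add (volume_inter_window_lt_top _).ne (volume_inter_window_lt_top _).ne]
    ring
  · simp [windowHom, KZ.of, windowMeasure]

theorem closure_domainAddRel_le_ker_windowHom :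
    AddSubgroup.closure KZ.domainAddRel ≤ windowHom.ker :=
  (AddSubgroup.closure_le _).mpr fun _ hc =>
    (AddMonoidHom.mem_ker).2 (windowHom_eq_zero_of_mem_domainAddRel hc)

/-- STRENGTHENING 2 / LOAD-BEARING (rule 2): planar chains of rule 1a only. -/
def PlanarCutsOnly : Prop :=
  ∀ r r' : KZ.IntegralRep 2, (∀ p ∈ r.domain, r.integrand p = 1) →
    (∀ p ∈ r'.domain, r'.integrand p = 1) → r.value = r'.value →
    KZ.of r - KZ.of r' ∈ AddSubgroup.closure
      (KZ.domainAddRel ∩ (AddSubgroup.closure PlanarOne : Set KZ.FormalRep))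

theorem windowHom_unitSquare : windowHom (KZ.of unitSquare) = 1 := by
  rw [windowHom_of_two, show unitSquare.domain = box ![0, 0] ![1, 1] from rfl, inter_self,
    volume_box_toReal (by intro i; fin_cases i <;> norm_num)]
  simp [Fin.prod_univ_two]

theorem windowHom_farSquare : windowHom (KZ.of farSquare) = 0 := by
  rw [windowHom_of_two, show farSquare.domain = box ![2, 0] ![3, 1] from rfl]
  have : box ![2, 0] ![3, 1] ∩ box ![0, 0] ![1, 1] = ∅ := by
    ext p
    simp only [mem_inter_iff, mem_empty_iff_false, iff_false, not_and]
    intro hp hp'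
    have h1 := (mem_box.mp hp 0).1
    have h2 := (mem_box.mp hp' 0).2
    simp at h1 h2
    linarith
  rw [this]
  simp

/-- `PlanarCutsOnly` is FALSE: `(0,1)²` versus its translate `(2,3) × (0,1)`. -/
theorem not_planarCutsOnly : ¬ PlanarCutsOnly := by
  intro h
  have hmem := h unitSquare farSquare (fun _ _ => rfl) (fun _ _ => rfl)
    (value_unitSquare.trans value_farSquare.symm)
  have hle : AddSubgroup.closure (KZ.domainAddRel ∩ (AddSubgroup.closure PlanarOne : Set KZ.FormalRep))
      ≤ windowHom.ker :=
    (AddSubgroup.closure_mono inter_subset_left).trans closure_domainAddRel_le_ker_windowHom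
  have h0 := hle hmem
  rw [AddMonoidHom.mem_ker, map_sub, windowHom_unitSquare, windowHom_farSquare] at h0
  norm_num at h0

/-! ## §3 POSITIVE BY-PRODUCTS (bookkeeping templates for the provers; not landable by a refuter)

* null planar sets vanish in `G` (the `TransportToGroup` bookkeeping);
* single planar instances of rules 1a / 2 lie in `G`;
* NON-VACUITY: the hypotheses of `PlanarK0Injective` are met non-trivially and its conclusion then
  holds — `(0,1)² ∼ (0,2) × (0,½)` by ONE rule-2 instance `diag(2, ½)` (a worked template of a
  planar `changeOfVariablesRel` membership: semialgebraicity, derivative, injectivity, image, det). -/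

/-- A null planar integrand-1 set is `0` in `G`: `[N] = [N ∪ N] = [N] + [N]` by rule 1a. -/
theorem of_mem_planarChainGroup_of_null (s : KZ.IntegralRep 2)
    (hs : ∀ p ∈ s.domain, s.integrand p = 1) (h0 : volume s.domain = 0) :
    KZ.of s ∈ planarChainGroup := by
  have hP : KZ.of s ∈ AddSubgroup.closure PlanarOne := AddSubgroup.subset_closure ⟨s, hs, rfl⟩
  have hgen : KZ.of s - KZ.of s - KZ.of s ∈ (KZ.domainAddRel ∪ KZ.changeOfVariablesRel) ∩
      (AddSubgroup.closure PlanarOne : Set KZ.FormalRep) := by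
    refine ⟨Or.inl ⟨2, s, s, s, (union_self _).symm, by simpa using h0, fun _ _ => rfl,
      fun _ _ => rfl, rfl⟩, ?_⟩
    have : KZ.of s - KZ.of s - KZ.of s = -KZ.of s := by abel
    rw [SetLike.mem_coe, this]
    exact neg_mem hP
  have h : KZ.of s - KZ.of s - KZ.of s ∈ planarChainGroup := AddSubgroup.subset_closure hgen
  have h' : KZ.of s - KZ.of s - KZ.of s = -KZ.of s := by abel
  rw [h'] at h
  simpa using neg_mem h

/-- A planar rule-2 instance between integrand-1 sets is a generator of `G`. -/
theorem sub_mem_planarChainGroup_of_cov {r r' : KZ.IntegralRep 2}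
    (hr : ∀ p ∈ r.domain, r.integrand p = 1) (hr' : ∀ p ∈ r'.domain, r'.integrand p = 1)
    (h : KZ.of r - KZ.of r' ∈ KZ.changeOfVariablesRel) : KZ.of r - KZ.of r' ∈ planarChainGroup :=
  AddSubgroup.subset_closure ⟨Or.inr h, sub_mem (AddSubgroup.subset_closure ⟨r, hr, rfl⟩)
    (AddSubgroup.subset_closure ⟨r', hr', rfl⟩)⟩

/-- A planar rule-1a instance among integrand-1 sets is a generator of `G`. -/
theorem sub_mem_planarChainGroup_of_cut {r r₁ r₂ : KZ.IntegralRep 2}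
    (hr : ∀ p ∈ r.domain, r.integrand p = 1) (hr₁ : ∀ p ∈ r₁.domain, r₁.integrand p = 1)
    (hr₂ : ∀ p ∈ r₂.domain, r₂.integrand p = 1)
    (h : KZ.of r - KZ.of r₁ - KZ.of r₂ ∈ KZ.domainAddRel) :
    KZ.of r - KZ.of r₁ - KZ.of r₂ ∈ planarChainGroup :=
  AddSubgroup.subset_closure ⟨Or.inl h, sub_mem (sub_mem (AddSubgroup.subset_closure ⟨r, hr, rfl⟩)
    (AddSubgroup.subset_closure ⟨r₁, hr₁, rfl⟩)) (AddSubgroup.subset_closure ⟨r₂, hr₂, rfl⟩)⟩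


/-- OFF-DOMAIN JUNK IS HARMLESS: two integrand-1 representations with the SAME domain (integrands
may differ off the domain, so `r ≠ r'` as structures) differ by ONE rule-2 instance, `Φ = id`. -/
theorem sub_mem_cov_of_domain_eq {r r' : KZ.IntegralRep 2} (hr : ∀ p ∈ r.domain, r.integrand p = 1)
    (hr' : ∀ p ∈ r'.domain, r'.integrand p = 1) (hdom : r.domain = r'.domain) :
    KZ.of r - KZ.of r' ∈ KZ.changeOfVariablesRel := by
  refine ⟨2, r, r', id, fun _ => ContinuousLinearMap.id ℝ (Fin 2 → ℝ),
    isSemialgebraicMapOn_id r.isSemialgebraic_domain,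
    fun x _ => (ContinuousLinearMap.id ℝ (Fin 2 → ℝ)).hasFDerivWithinAt, injOn_id _,
    by rw [image_id, hdom], fun x hx => ?_, rfl⟩
  rw [hr x hx, hr' (id x) (hdom ▸ hx)]
  have : (ContinuousLinearMap.id ℝ (Fin 2 → ℝ)).det = 1 := by
    show LinearMap.det ((ContinuousLinearMap.id ℝ (Fin 2 → ℝ) : (Fin 2 → ℝ) →ₗ[ℝ] (Fin 2 → ℝ))) = 1
    rw [ContinuousLinearMap.coe_id, LinearMap.det_id]
  rw [this]
  simp

/-- Hence same-domain integrand-1 representations are equal in `G`. -/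
theorem sub_mem_planarChainGroup_of_domain_eq {r r' : KZ.IntegralRep 2}
    (hr : ∀ p ∈ r.domain, r.integrand p = 1) (hr' : ∀ p ∈ r'.domain, r'.integrand p = 1)
    (hdom : r.domain = r'.domain) : KZ.of r - KZ.of r' ∈ planarChainGroup :=
  sub_mem_planarChainGroup_of_cov hr hr' (sub_mem_cov_of_domain_eq hr hr' hdom)

/-! ### §3.1 Non-vacuity: `(0,1)² ∼ (0,2) × (0,½)` by ONE planar rule-2 instance `diag(2, ½)` -/

/-- The matrix `diag(2, ½)`. -/
def diagMat : Matrix (Fin 2) (Fin 2) ℝ := !![2, 0; 0, 1 / 2]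

/-- `diag(2, ½)` as a continuous linear map of `ℝ²`. -/
def diagL : (Fin 2 → ℝ) →L[ℝ] (Fin 2 → ℝ) :=
  LinearMap.toContinuousLinearMap (Matrix.toLin' diagMat)

theorem diagL_apply (p : Fin 2 → ℝ) : diagL p = ![2 * p 0, p 1 / 2] := by
  ext i
  fin_cases i
  · simp [diagL, diagMat, Matrix.toLin'_apply, Matrix.mulVec, dotProduct, Fin.sum_univ_two]
  · simp [diagL, diagMat, Matrix.toLin'_apply, Matrix.mulVec, dotProduct, Fin.sum_univ_two]
    ring

theorem det_diagL : diagL.det = 1 := by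
  show LinearMap.det (diagL : (Fin 2 → ℝ) →ₗ[ℝ] (Fin 2 → ℝ)) = 1
  rw [show (diagL : (Fin 2 → ℝ) →ₗ[ℝ] (Fin 2 → ℝ)) = Matrix.toLin' diagMat from rfl,
    LinearMap.det_toLin']
  norm_num [diagMat, Matrix.det_fin_two_of]

/-- The wide rectangle `(0,2) × (0,½)`. -/
def wideRect : KZ.IntegralRep 2 := boxRep ![0, 0] ![2, 1 / 2]

theorem value_wideRect : wideRect.value = 1 := by
  rw [wideRect, value_boxRep] <;> norm_num [Fin.forall_fin_two]

/-- TEMPLATE: `[(0,1)²] − [(0,2) × (0,½)] ∈ changeOfVariablesRel` via `Φ = diag(2, ½)`. -/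
theorem unitSquare_sub_wideRect_mem_cov :
    KZ.of unitSquare - KZ.of wideRect ∈ KZ.changeOfVariablesRel := by
  refine ⟨2, unitSquare, wideRect, diagL, fun _ => diagL, ?_, ?_, ?_, ?_, ?_, rfl⟩
  · -- semialgebraic: a polynomial map with rational coefficients
    refine (isSemialgebraicMapOn_aeval (isSemialgebraic_box ![0, 0] ![1, 1])
      ![C 2 * X 0, C (1 / 2) * X 1]).congr ?_
    intro p _
    rw [diagL_apply]
    ext i
    fin_cases i
    · simp
    · simp; ring
  · exact fun x _ => diagL.hasFDerivWithinAt
  · intro p _ q _ hpq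
    rw [diagL_apply, diagL_apply] at hpq
    have h0 := congr_fun hpq 0
    have h1 := congr_fun hpq 1
    simp at h0 h1
    ext i
    fin_cases i
    · simpa using h0
    · simpa using h1
  · ext q
    rw [show wideRect.domain = box ![0, 0] ![2, 1 / 2] from rfl,
      show unitSquare.domain = box ![0, 0] ![1, 1] from rfl, mem_image]
    constructor
    · intro hq
      have h0 := mem_box.mp hq 0
      have h1 := mem_box.mp hq 1
      simp at h0 h1
      refine ⟨![q 0 / 2, 2 * q 1], ?_, ?_⟩
      · rw [mem_box]
        intro i
        fin_cases i <;> simp <;> constructor <;> linarith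
      · rw [diagL_apply]
        ext i
        fin_cases i
        · simp; ring
        · simp
    · rintro ⟨p, hp, rfl⟩
      have h0 := mem_box.mp hp 0
      have h1 := mem_box.mp hp 1
      simp at h0 h1
      rw [mem_box, diagL_apply]
      intro i
      fin_cases i <;> simp <;> constructor <;> linarith
  · intro x _
    simp [det_diagL, show unitSquare.integrand = fun _ => (1 : ℝ) from rfl,
      show wideRect.integrand = fun _ => (1 : ℝ) from rfl]

/-- NON-VACUITY of the crux data: distinct planar integrand-1 sets of equal area whose difference
IS a planar set-chain (one generator). -/
theorem cruxHypotheses_satisfiable_nontrivially :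
    ∃ r r' : KZ.IntegralRep 2, r.domain ≠ r'.domain ∧ (∀ p ∈ r.domain, r.integrand p = 1) ∧
      (∀ p ∈ r'.domain, r'.integrand p = 1) ∧ r.value = r'.value ∧
      KZ.of r - KZ.of r' ∈ planarChainGroup := by
  refine ⟨unitSquare, wideRect, ?_, fun _ _ => rfl, fun _ _ => rfl,
    value_unitSquare.trans value_wideRect.symm,
    sub_mem_planarChainGroup_of_cov (fun _ _ => rfl) (fun _ _ => rfl)
      unitSquare_sub_wideRect_mem_cov⟩
  intro h
  have hq : (![3 / 2, 1 / 4] : Fin 2 → ℝ) ∈ wideRect.domain := by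
    rw [show wideRect.domain = box ![0, 0] ![2, 1 / 2] from rfl, mem_box]
    intro i; fin_cases i <;> norm_num
  rw [← h] at hq
  have := (mem_box.mp hq 0).2
  norm_num at this


/-! ## §4 ANTECEDENT AUDIT — tightness of the inlined Green generator

The antecedent of the crux (= `RealOnePeriodRelations`, inlined) adds to rules 1a/1b/2 the GREEN
GENERATOR: `[∫₀¹A(t,0)dt] + [∫₀¹(B − A)(1−t,t)dt] − [∫₀¹B(0,t)dt]` for `A, B` ℚ-semialgebraic and
CONTINUOUS ON THE CLOSED TRIANGLE with a `C¹` potential `S` on the open triangle. Soundness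
(eval = ∮_{∂Δ}(A da + B db) = 0) uses the closed-triangle continuity essentially: relax it to
continuity off ONE vertex and the angle form `dθ` around that vertex is admitted, with period
`π/2`. Consequences: (i) the antecedent is correctly typed (not junk-unsound), so channel (K1)
needs a genuine non-`eval` invariant; (ii) `CurvePeriodsTransfer` must produce `A, B` continuous
up to the boundary (residues at vertices are NOT Green instances — they must be routed through
1a/2 after excising the vertex); (iii) the compiler Θ only ever meets bounded continuous
`A, B` on `Δ` — the "integrable blow-ups" of the why-line occur at cell ends of 1-dim reps, not
inside Green data. -/

/-- The open unit interval as a domain in `ℝ¹`. -/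
def unitIoo : Set (Fin 1 → ℝ) := {z | z 0 ∈ Ioo (0 : ℝ) 1}

theorem unitIoo_eq_pi : unitIoo = Set.pi univ fun _ : Fin 1 => Ioo (0 : ℝ) 1 := by
  ext z; simp [unitIoo, Fin.forall_fin_one]

theorem isSemialgebraic_unitIoo : IsSemialgebraic ℚ unitIoo := by
  have h := (isSemialgebraic_setOf_eval_lt (k := ℚ) (R := ℝ) (ι := Fin 1) (C 0) (X 0)).inter
    (isSemialgebraic_setOf_eval_lt (k := ℚ) (R := ℝ) (ι := Fin 1) (X 0) (C 1))
  have hEq : unitIoo =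
      {x : Fin 1 → ℝ | aeval x (C 0 : MvPolynomial (Fin 1) ℚ) < aeval x (X 0 : MvPolynomial (Fin 1) ℚ)} ∩
      {x : Fin 1 → ℝ | aeval x (X 0 : MvPolynomial (Fin 1) ℚ) < aeval x (C 1 : MvPolynomial (Fin 1) ℚ)} := by
    ext z; simp [unitIoo]
  rw [hEq]; exact h

theorem measurableSet_unitIoo : MeasurableSet unitIoo := by
  rw [unitIoo_eq_pi]; exact MeasurableSet.univ_pi fun _ => measurableSet_Ioo

theorem volume_unitIoo_toReal : (volume unitIoo).toReal = 1 := by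
  rw [unitIoo_eq_pi, Real.volume_pi_Ioo_toReal (fun _ => zero_le_one)]
  simp

theorem volume_unitIoo_lt_top : volume unitIoo < ⊤ := by
  rw [unitIoo_eq_pi, Real.volume_pi_Ioo]
  exact ENNReal.prod_lt_top fun _ _ => ENNReal.ofReal_lt_top

/-- The zero representation on `(0,1)`. -/
def zeroRep : KZ.IntegralRep 1 where
  domain := unitIoo
  integrand := fun _ => 0
  isSemialgebraic_domain := isSemialgebraic_unitIoo
  isSemialgebraicFunOn_integrand := by
    simpa using isSemialgebraicFunOn_aeval isSemialgebraic_unitIoo (C 0 : MvPolynomial (Fin 1) ℚ)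
  integrableOn := integrableOn_zero

@[simp] theorem value_zeroRep : zeroRep.value = 0 := by
  simp [KZ.IntegralRep.value, zeroRep]

/-- The hypotenuse integrand of the angle form: `t ↦ 1 / ((1 − t)² + t²)`. -/
def hypDensity : (Fin 1 → ℝ) → ℝ := fun z => 1 / ((1 - z 0) ^ 2 + z 0 ^ 2)

theorem hypDen_pos (t : ℝ) : 0 < (1 - t) ^ 2 + t ^ 2 := by nlinarith [sq_nonneg (1 - t), sq_nonneg t, sq_nonneg (2 * t - 1)]

theorem continuous_hypDensity : Continuous hypDensity := by
  unfold hypDensity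
  exact continuous_const.div (by fun_prop) fun z => (hypDen_pos (z 0)).ne'

theorem isSemialgebraicFunOn_hypDensity : IsSemialgebraicFunOn ℚ unitIoo hypDensity := by
  refine (isSemialgebraicFunOn_aeval_div_aeval isSemialgebraic_unitIoo (C 1)
    ((C 1 - X 0) ^ 2 + X 0 ^ 2) ?_).congr ?_
  · intro z _
    simpa using (hypDen_pos (z 0)).ne'
  · intro z _
    simp [hypDensity]

theorem integrableOn_hypDensity : IntegrableOn hypDensity unitIoo := by
  have hK : IsCompact (Set.pi univ fun _ : Fin 1 => Icc (0 : ℝ) 1) :=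
    isCompact_univ_pi fun _ => isCompact_Icc
  refine (continuous_hypDensity.continuousOn.integrableOn_compact hK).mono_set ?_
  rw [unitIoo_eq_pi]
  exact Set.pi_mono fun _ _ => Ioo_subset_Icc_self

/-- `[∫₀¹ dt / ((1−t)² + t²)]` (value `π/2`). -/
def hypRep : KZ.IntegralRep 1 where
  domain := unitIoo
  integrand := hypDensity
  isSemialgebraic_domain := isSemialgebraic_unitIoo
  isSemialgebraicFunOn_integrand := isSemialgebraicFunOn_hypDensity
  integrableOn := integrableOn_hypDensity

/-- `1 ≤ value hypRep` (indeed `= π/2`; the lower bound suffices). -/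
theorem one_le_value_hypRep : 1 ≤ hypRep.value := by
  have h1 : ∫ z in unitIoo, (1 : ℝ) = 1 := by
    rw [setIntegral_const, smul_eq_mul, mul_one, measureReal_def, volume_unitIoo_toReal]
  rw [KZ.IntegralRep.value, show hypRep.domain = unitIoo from rfl,
    show hypRep.integrand = hypDensity from rfl, ← h1]
  refine setIntegral_mono_on (integrableOn_const volume_unitIoo_lt_top.ne) integrableOn_hypDensity
    measurableSet_unitIoo fun z hz => ?_
  have ht := hz
  simp only [unitIoo, mem_setOf_eq, mem_Ioo] at ht
  rw [hypDensity, le_div_iff₀ (hypDen_pos (z 0))]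
  nlinarith [ht.1, ht.2]

/-- The angle form `dθ` around the vertex `0`: `A = −b/(a²+b²)`, `B = a/(a²+b²)` (value `0` at the
vertex by Lean's `x / 0 = 0`), potential `S = arctan (b/a)` on `{a > 0}`. -/
def angA : (Fin 2 → ℝ) → ℝ := fun p => -p 1 / (p 0 ^ 2 + p 1 ^ 2)
def angB : (Fin 2 → ℝ) → ℝ := fun p => p 0 / (p 0 ^ 2 + p 1 ^ 2)
def angS : (Fin 2 → ℝ) → ℝ := fun p => Real.arctan (p 1 * (p 0)⁻¹)

/-- The closed standard triangle. -/
def triangle : Set (Fin 2 → ℝ) := {p | 0 ≤ p 0 ∧ 0 ≤ p 1 ∧ p 0 + p 1 ≤ 1}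

theorem isSemialgebraic_triangle : IsSemialgebraic ℚ triangle := by
  have h := ((isSemialgebraic_setOf_eval_le (k := ℚ) (R := ℝ) (ι := Fin 2) (C 0) (X 0)).inter
    (isSemialgebraic_setOf_eval_le (k := ℚ) (R := ℝ) (ι := Fin 2) (C 0) (X 1))).inter
    (isSemialgebraic_setOf_eval_le (k := ℚ) (R := ℝ) (ι := Fin 2) (X 0 + X 1) (C 1))
  have hEq : triangle =
      ({x : Fin 2 → ℝ | aeval x (C 0 : MvPolynomial (Fin 2) ℚ) ≤ aeval x (X 0 : MvPolynomial (Fin 2) ℚ)} ∩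
        {x : Fin 2 → ℝ | aeval x (C 0 : MvPolynomial (Fin 2) ℚ) ≤ aeval x (X 1 : MvPolynomial (Fin 2) ℚ)}) ∩
      {x : Fin 2 → ℝ | aeval x (X 0 + X 1 : MvPolynomial (Fin 2) ℚ) ≤ aeval x (C 1 : MvPolynomial (Fin 2) ℚ)} := by
    ext p; simp [triangle, and_assoc]
  rw [hEq]; exact h

theorem isSemialgebraic_origin : IsSemialgebraic ℚ ({0} : Set (Fin 2 → ℝ)) := by
  have h := (isSemialgebraic_setOf_eval_eq_zero (k := ℚ) (R := ℝ) (ι := Fin 2) (X 0)).inter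
    (isSemialgebraic_setOf_eval_eq_zero (k := ℚ) (R := ℝ) (ι := Fin 2) (X 1))
  have hEq : ({0} : Set (Fin 2 → ℝ)) =
      {x : Fin 2 → ℝ | aeval x (X 0 : MvPolynomial (Fin 2) ℚ) = 0} ∩
      {x : Fin 2 → ℝ | aeval x (X 1 : MvPolynomial (Fin 2) ℚ) = 0} := by
    ext p
    simp only [mem_singleton_iff, mem_inter_iff, mem_setOf_eq, aeval_X]
    constructor
    · rintro rfl; simp
    · rintro ⟨h0, h1⟩; ext i; fin_cases i <;> simp [h0, h1]
  rw [hEq]; exact h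

theorem sq_add_sq_ne_zero_of_ne_zero {p : Fin 2 → ℝ} (hp : p ≠ 0) : p 0 ^ 2 + p 1 ^ 2 ≠ 0 := by
  intro h
  have h0 : p 0 = 0 := by nlinarith [sq_nonneg (p 0), sq_nonneg (p 1)]
  have h1 : p 1 = 0 := by nlinarith [sq_nonneg (p 0), sq_nonneg (p 1)]
  exact hp (by ext i; fin_cases i <;> simp [h0, h1])

/-- Gluing: a function semialgebraic on `s` and on `t` is semialgebraic on `s ∪ t`. -/
theorem isSemialgebraicFunOn_union {n : ℕ} {s t : Set (Fin n → ℝ)} {f : (Fin n → ℝ) → ℝ}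
    (hs : IsSemialgebraicFunOn ℚ s f) (ht : IsSemialgebraicFunOn ℚ t f) :
    IsSemialgebraicFunOn ℚ (s ∪ t) f := by
  unfold IsSemialgebraicFunOn at hs ht ⊢
  convert hs.union ht using 1
  ext z
  simp only [mem_setOf_eq, mem_union]
  constructor
  · rintro ⟨x, hx | hx, rfl⟩
    · exact Or.inl ⟨x, hx, rfl⟩
    · exact Or.inr ⟨x, hx, rfl⟩
  · rintro (⟨x, hx, rfl⟩ | ⟨x, hx, rfl⟩)
    · exact ⟨x, Or.inl hx, rfl⟩
    · exact ⟨x, Or.inr hx, rfl⟩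

/-- A rational function `p/q` extended by `0` where `q = 0` is semialgebraic on any semialgebraic set
(glue the graph over `{q ≠ 0}` with the zero graph over `{q = 0}`). -/
theorem isSemialgebraicFunOn_div_total {s : Set (Fin 2 → ℝ)} (hs : IsSemialgebraic ℚ s)
    (P Q : MvPolynomial (Fin 2) ℚ) :
    IsSemialgebraicFunOn ℚ s (fun x => aeval x P / aeval x Q) := by
  have hne : IsSemialgebraic ℚ (s ∩ {x : Fin 2 → ℝ | aeval x Q ≠ 0}) :=
    hs.inter (isSemialgebraic_setOf_eval_ne_zero Q)
  have heq : IsSemialgebraic ℚ (s ∩ {x : Fin 2 → ℝ | aeval x Q = 0}) :=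
    hs.inter (isSemialgebraic_setOf_eval_eq_zero Q)
  have h1 : IsSemialgebraicFunOn ℚ (s ∩ {x : Fin 2 → ℝ | aeval x Q ≠ 0}) (fun x => aeval x P / aeval x Q) :=
    isSemialgebraicFunOn_aeval_div_aeval hne P Q fun x hx => hx.2
  have h2 : IsSemialgebraicFunOn ℚ (s ∩ {x : Fin 2 → ℝ | aeval x Q = 0}) (fun x => aeval x P / aeval x Q) := by
    refine (isSemialgebraicFunOn_aeval heq (C 0)).congr ?_
    intro x hx
    have hq : aeval x Q = 0 := hx.2
    simp [hq]
  convert isSemialgebraicFunOn_union h1 h2 using 1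
  ext x
  simp only [mem_union, mem_inter_iff, mem_setOf_eq]
  tauto

theorem isSemialgebraicFunOn_angA : IsSemialgebraicFunOn ℚ triangle angA := by
  refine (isSemialgebraicFunOn_div_total isSemialgebraic_triangle (-X 1) (X 0 ^ 2 + X 1 ^ 2)).congr ?_
  intro p _; simp [angA, neg_div]

theorem isSemialgebraicFunOn_angB : IsSemialgebraicFunOn ℚ triangle angB := by
  refine (isSemialgebraicFunOn_div_total isSemialgebraic_triangle (X 0) (X 0 ^ 2 + X 1 ^ 2)).congr ?_
  intro p _; simp [angB]

theorem continuousOn_angA : ContinuousOn angA (triangle \ {0}) := by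
  refine ContinuousOn.div (by fun_prop) (by fun_prop) fun p hp => ?_
  exact sq_add_sq_ne_zero_of_ne_zero hp.2

theorem continuousOn_angB : ContinuousOn angB (triangle \ {0}) := by
  refine ContinuousOn.div (by fun_prop) (by fun_prop) fun p hp => ?_
  exact sq_add_sq_ne_zero_of_ne_zero hp.2

/-- `dS = A da + B db` on `{a > 0}` (in particular on the open triangle). -/
theorem hasFDerivAt_angS {p : Fin 2 → ℝ} (h0 : 0 < p 0) :
    HasFDerivAt angS (angA p • ContinuousLinearMap.proj (R := ℝ) (φ := fun _ : Fin 2 => ℝ) 0 +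
      angB p • ContinuousLinearMap.proj (R := ℝ) (φ := fun _ : Fin 2 => ℝ) 1) p := by
  have hinv : HasFDerivAt (fun q : Fin 2 → ℝ => (q 0)⁻¹)
      ((-(p 0 ^ 2)⁻¹) • ContinuousLinearMap.proj (R := ℝ) (φ := fun _ : Fin 2 => ℝ) 0) p :=
    (hasDerivAt_inv h0.ne').comp_hasFDerivAt p (hasFDerivAt_apply 0 p)
  have hmul : HasFDerivAt (fun q : Fin 2 → ℝ => q 1 * (q 0)⁻¹)
      (p 1 • ((-(p 0 ^ 2)⁻¹) • ContinuousLinearMap.proj (R := ℝ) (φ := fun _ : Fin 2 => ℝ) 0) +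
        (p 0)⁻¹ • ContinuousLinearMap.proj (R := ℝ) (φ := fun _ : Fin 2 => ℝ) 1) p :=
    (hasFDerivAt_apply 1 p).mul hinv
  have harc := (Real.hasDerivAt_arctan (p 1 * (p 0)⁻¹)).comp_hasFDerivAt p hmul
  refine harc.congr_fderiv ?_
  have hp0 : p 0 ≠ 0 := h0.ne'
  have hD : p 0 ^ 2 + p 1 ^ 2 ≠ 0 := by positivity
  ext v
  simp [angA, angB]
  field_simp

/-- The relaxed Green generator: the inlined generator of the crux's antecedent with
`ContinuousOn A Δ ∧ ContinuousOn B Δ` weakened to continuity on `Δ ∖ {0}` (all else verbatim). -/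
def greenRelaxed : Set KZ.FormalRep :=
  {g | ∃ (Δ : Set (Fin 2 → ℝ)) (A B S : (Fin 2 → ℝ) → ℝ) (r₀₁ r₁₂ r₀₂ : KZ.IntegralRep 1),
    Δ = {p | 0 ≤ p 0 ∧ 0 ≤ p 1 ∧ p 0 + p 1 ≤ 1} ∧ IsSemialgebraicFunOn ℚ Δ A ∧
    IsSemialgebraicFunOn ℚ Δ B ∧ ContinuousOn A (Δ \ {0}) ∧ ContinuousOn B (Δ \ {0}) ∧
    (∀ p : Fin 2 → ℝ, 0 < p 0 → 0 < p 1 → p 0 + p 1 < 1 →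
      HasFDerivAt S (A p • ContinuousLinearMap.proj (R := ℝ) (φ := fun _ : Fin 2 => ℝ) 0 +
        B p • ContinuousLinearMap.proj (R := ℝ) (φ := fun _ : Fin 2 => ℝ) 1) p) ∧
    r₀₁.domain = {z | z 0 ∈ Set.Ioo 0 1} ∧ r₁₂.domain = {z | z 0 ∈ Set.Ioo 0 1} ∧
    r₀₂.domain = {z | z 0 ∈ Set.Ioo 0 1} ∧
    (∀ z ∈ r₀₁.domain, r₀₁.integrand z = A ![z 0, 0]) ∧
    (∀ z ∈ r₁₂.domain, r₁₂.integrand z = B ![1 - z 0, z 0] - A ![1 - z 0, z 0]) ∧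
    (∀ z ∈ r₀₂.domain, r₀₂.integrand z = B ![0, z 0]) ∧
    g = KZ.of r₀₁ + KZ.of r₁₂ - KZ.of r₀₂}

/-- The angle form is a relaxed Green instance: `[0] + [hypRep] − [0]`. -/
theorem angleForm_mem_greenRelaxed :
    KZ.of zeroRep + KZ.of hypRep - KZ.of zeroRep ∈ greenRelaxed := by
  refine ⟨triangle, angA, angB, angS, zeroRep, hypRep, zeroRep, rfl, isSemialgebraicFunOn_angA,
    isSemialgebraicFunOn_angB, continuousOn_angA, continuousOn_angB,
    fun p h0 _ _ => hasFDerivAt_angS h0, rfl, rfl, rfl, ?_, ?_, ?_, rfl⟩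
  · intro z _; simp [zeroRep, angA]
  · intro z _
    have hD := hypDen_pos (z 0)
    simp only [hypRep, hypDensity, angA, angB, Matrix.cons_val_zero, Matrix.cons_val_one]
    field_simp
    ring
  · intro z _; simp [zeroRep, angB]

/-- TIGHTNESS of the antecedent's Green generator: continuity of `A, B` on the CLOSED triangle is
load-bearing for soundness — the relaxed generator has an element of value `≥ 1` (`= π/2`). -/
theorem greenRelaxed_unsound : ∃ g ∈ greenRelaxed, KZ.eval g ≠ 0 := by
  refine ⟨_, angleForm_mem_greenRelaxed, ?_⟩
  rw [map_sub, map_add, KZ.eval_of, KZ.eval_of, value_zeroRep, zero_add, sub_zero]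
  exact (lt_of_lt_of_le zero_lt_one one_le_value_hypRep).ne'


/-! ### §4.2 Orientation of the Green generator is typed exactly right (slip checks)

The three edge terms carry the counter-clockwise orientation of `∂Δ`: `+[∫A(t,0)]` (bottom edge),
`+[∫(B − A)(1−t,t)]` (hypotenuse, `da = −dt`, `db = dt`), `−[∫B(0,t)]` (left edge, traversed
downwards). Each of the two natural slips is UNSOUND already for the exact form `η = db`
(`A = 0`, `B = 1`, `S = b`): sign slip on the left edge (`… + [∫B(0,t)]`, eval `2`) and orientation
slip on the hypotenuse (`[∫(A − B)(1−t,t)]`, eval `−2`). So a prover may trust the typed signs, and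
the transfer (CurvePeriodsTransfer) must orient its semialgebraic triangles accordingly. -/

/-- The constant-`1` representation on `(0,1)`. -/
def oneRep : KZ.IntegralRep 1 where
  domain := unitIoo
  integrand := fun _ => 1
  isSemialgebraic_domain := isSemialgebraic_unitIoo
  isSemialgebraicFunOn_integrand := by
    simpa using isSemialgebraicFunOn_aeval isSemialgebraic_unitIoo (C 1 : MvPolynomial (Fin 1) ℚ)
  integrableOn := integrableOn_const volume_unitIoo_lt_top.ne

@[simp] theorem value_oneRep : oneRep.value = 1 := by
  rw [KZ.IntegralRep.value, show oneRep.integrand = fun _ => (1 : ℝ) from rfl, setIntegral_const,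
    smul_eq_mul, mul_one, measureReal_def, show oneRep.domain = unitIoo from rfl, volume_unitIoo_toReal]

/-- The potential `S = b` (exact form `db`): `A = 0`, `B = 1`. -/
theorem hasFDerivAt_snd (p : Fin 2 → ℝ) :
    HasFDerivAt (fun q : Fin 2 → ℝ => q 1)
      ((0 : ℝ) • ContinuousLinearMap.proj (R := ℝ) (φ := fun _ : Fin 2 => ℝ) 0 +
        (1 : ℝ) • ContinuousLinearMap.proj (R := ℝ) (φ := fun _ : Fin 2 => ℝ) 1) p := by
  have h := hasFDerivAt_apply (𝕜 := ℝ) 1 p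
  refine h.congr_fderiv ?_
  ext v
  simp

/-- Green data predicate shared by the slip variants (everything as typed in the crux). -/
def IsGreenData (A B S : (Fin 2 → ℝ) → ℝ) (r₀₁ r₁₂' r₀₂ : KZ.IntegralRep 1)
    (hyp : (Fin 2 → ℝ) → ℝ) : Prop :=
  IsSemialgebraicFunOn ℚ triangle A ∧ IsSemialgebraicFunOn ℚ triangle B ∧
    ContinuousOn A triangle ∧ ContinuousOn B triangle ∧
    (∀ p : Fin 2 → ℝ, 0 < p 0 → 0 < p 1 → p 0 + p 1 < 1 →
      HasFDerivAt S (A p • ContinuousLinearMap.proj (R := ℝ) (φ := fun _ : Fin 2 => ℝ) 0 +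
        B p • ContinuousLinearMap.proj (R := ℝ) (φ := fun _ : Fin 2 => ℝ) 1) p) ∧
    r₀₁.domain = {z | z 0 ∈ Set.Ioo 0 1} ∧ r₁₂'.domain = {z | z 0 ∈ Set.Ioo 0 1} ∧
    r₀₂.domain = {z | z 0 ∈ Set.Ioo 0 1} ∧
    (∀ z ∈ r₀₁.domain, r₀₁.integrand z = A ![z 0, 0]) ∧
    (∀ z ∈ r₁₂'.domain, r₁₂'.integrand z = hyp ![1 - z 0, z 0]) ∧
    (∀ z ∈ r₀₂.domain, r₀₂.integrand z = B ![0, z 0])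

/-- SLIP 1 (sign of the left edge): `g = [r₀₁] + [r₁₂] + [r₀₂]` with the typed hypotenuse `B − A`. -/
def greenLeftSignSlip : Set KZ.FormalRep :=
  {g | ∃ (A B S : (Fin 2 → ℝ) → ℝ) (r₀₁ r₁₂ r₀₂ : KZ.IntegralRep 1),
    IsGreenData A B S r₀₁ r₁₂ r₀₂ (fun p => B p - A p) ∧ g = KZ.of r₀₁ + KZ.of r₁₂ + KZ.of r₀₂}

/-- SLIP 2 (orientation of the hypotenuse): integrand `(A − B)(1−t,t)`, typed signs elsewhere. -/
def greenHypotenuseSlip : Set KZ.FormalRep :=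
  {g | ∃ (A B S : (Fin 2 → ℝ) → ℝ) (r₀₁ r₁₂ r₀₂ : KZ.IntegralRep 1),
    IsGreenData A B S r₀₁ r₁₂ r₀₂ (fun p => A p - B p) ∧ g = KZ.of r₀₁ + KZ.of r₁₂ - KZ.of r₀₂}

theorem isGreenData_db (hyp : (Fin 2 → ℝ) → ℝ) (r : KZ.IntegralRep 1) (hr : r.domain = unitIoo)
    (hint : ∀ z ∈ r.domain, r.integrand z = hyp ![1 - z 0, z 0]) :
    IsGreenData (fun _ => 0) (fun _ => 1) (fun q => q 1) zeroRep r oneRep hyp := by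
  refine ⟨?_, ?_, continuousOn_const, continuousOn_const, fun p _ _ _ => hasFDerivAt_snd p,
    rfl, hr, rfl, fun _ _ => rfl, hint, fun _ _ => rfl⟩
  · simpa using isSemialgebraicFunOn_aeval isSemialgebraic_triangle (C 0 : MvPolynomial (Fin 2) ℚ)
  · simpa using isSemialgebraicFunOn_aeval isSemialgebraic_triangle (C 1 : MvPolynomial (Fin 2) ℚ)

/-- The left-edge sign slip is UNSOUND: `η = db` gives eval `0 + 1 + 1 = 2`. -/
theorem greenLeftSignSlip_unsound : ∃ g ∈ greenLeftSignSlip, KZ.eval g ≠ 0 := by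
  refine ⟨KZ.of zeroRep + KZ.of oneRep + KZ.of oneRep, ⟨fun _ => 0, fun _ => 1, fun q => q 1,
    zeroRep, oneRep, oneRep, isGreenData_db _ oneRep rfl (fun _ _ => by simp [oneRep]), rfl⟩, ?_⟩
  rw [map_add, map_add, KZ.eval_of, KZ.eval_of, value_zeroRep, value_oneRep]
  norm_num

/-- The constant `−1` representation on `(0,1)`. -/
def negOneRep : KZ.IntegralRep 1 where
  domain := unitIoo
  integrand := fun _ => -1
  isSemialgebraic_domain := isSemialgebraic_unitIoo
  isSemialgebraicFunOn_integrand := by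
    simpa using isSemialgebraicFunOn_aeval isSemialgebraic_unitIoo (C (-1) : MvPolynomial (Fin 1) ℚ)
  integrableOn := integrableOn_const volume_unitIoo_lt_top.ne

@[simp] theorem value_negOneRep : negOneRep.value = -1 := by
  rw [KZ.IntegralRep.value, show negOneRep.integrand = fun _ => (-1 : ℝ) from rfl, setIntegral_const,
    smul_eq_mul, measureReal_def, show negOneRep.domain = unitIoo from rfl, volume_unitIoo_toReal]
  norm_num

/-- The hypotenuse orientation slip is UNSOUND: `η = db` gives eval `0 + (−1) − 1 = −2`. -/
theorem greenHypotenuseSlip_unsound : ∃ g ∈ greenHypotenuseSlip, KZ.eval g ≠ 0 := by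
  refine ⟨KZ.of zeroRep + KZ.of negOneRep - KZ.of oneRep, ⟨fun _ => 0, fun _ => 1, fun q => q 1,
    zeroRep, negOneRep, oneRep, isGreenData_db _ negOneRep rfl (fun _ _ => by simp [negOneRep]),
    rfl⟩, ?_⟩
  rw [map_sub, map_add, KZ.eval_of, KZ.eval_of, KZ.eval_of, value_zeroRep, value_negOneRep,
    value_oneRep]
  norm_num

/-- SANITY (the typed orientation is sound on this datum): `0 + 1 − 1 = 0`. -/
theorem green_typed_db_sound :
    KZ.eval (KZ.of zeroRep + KZ.of oneRep - KZ.of oneRep) = 0 := by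
  rw [map_sub, map_add, KZ.eval_of, KZ.eval_of, value_zeroRep, value_oneRep]
  norm_num


/-! ## §5 THE FOLD IS REAL: the unsubdivided band reading of the Green step is FALSE

The route's plan compiles a Green instance `(A, B, S)` by the equal-Jacobian transport
`Ψ₂ ∘ Ψ₁⁻¹`, `Ψ₁ = (a, A)`, `Ψ₂ = (b, B)`, "after subdividing Δ by the sign of ∂_bA = ∂_aB". The
subdivision (equivalently: the twist-restoring shear, or signed multiplicities) is NOT cosmetic. The
naive reading — "the band swept by the vertical traces, `Ω₁ = {a ∈ (0,1), y between A(a,0) and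
A(a,1−a)}`, and the band swept by the horizontal traces, `Ω₂ = {b ∈ (0,1), w between B(0,b) and
B(1−b,b)}`, are equivalent planar sets" — is false already for the POLYNOMIAL potential
`S = (a² − a)·b` (`A = (2a−1)b`, `B = a² − a`, twist `S_ab = 2a − 1` changing sign on `a = ½`):
`area Ω₁ = ∫₀¹ |2a−1|(1−a) da = 1/4` but `area Ω₂ = ∫₀¹ (b − b²) db = 1/6`. Hence `Ω₁, Ω₂` are not
even KZ-equivalent (`not_naiveGreenBands`, soundness), let alone one rule-2 instance or a planar
chain. Signed, the identity holds (`∫₀¹ (2a−1)(1−a) da = −1/6`): the fold over `a < ½` is counted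
with the wrong sign by the unsigned band. Any line must see the sign of the twist. -/

/-- The fold datum: `A = (2a − 1)·b`. -/
def foldA : (Fin 2 → ℝ) → ℝ := fun p => (2 * p 0 - 1) * p 1
/-- The fold datum: `B = a² − a`. -/
def foldB : (Fin 2 → ℝ) → ℝ := fun p => p 0 ^ 2 - p 0
/-- The fold datum: `S = (a² − a)·b`, a polynomial potential with `dS = A da + B db` everywhere. -/
def foldS : (Fin 2 → ℝ) → ℝ := fun p => (p 0 ^ 2 - p 0) * p 1

theorem isSemialgebraicFunOn_foldA : IsSemialgebraicFunOn ℚ triangle foldA := by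
  refine (isSemialgebraicFunOn_aeval isSemialgebraic_triangle ((C 2 * X 0 - C 1) * X 1)).congr ?_
  intro p _; simp [foldA]

theorem isSemialgebraicFunOn_foldB : IsSemialgebraicFunOn ℚ triangle foldB := by
  refine (isSemialgebraicFunOn_aeval isSemialgebraic_triangle (X 0 ^ 2 - X 0)).congr ?_
  intro p _; simp [foldB]

theorem continuous_foldA : Continuous foldA := by unfold foldA; fun_prop
theorem continuous_foldB : Continuous foldB := by unfold foldB; fun_prop

/-- `dS = A da + B db` (everywhere). -/
theorem hasFDerivAt_foldS (p : Fin 2 → ℝ) :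
    HasFDerivAt foldS (foldA p • ContinuousLinearMap.proj (R := ℝ) (φ := fun _ : Fin 2 => ℝ) 0 +
      foldB p • ContinuousLinearMap.proj (R := ℝ) (φ := fun _ : Fin 2 => ℝ) 1) p := by
  have h0 : HasFDerivAt (fun q : Fin 2 → ℝ => q 0) (ContinuousLinearMap.proj (R := ℝ)
      (φ := fun _ : Fin 2 => ℝ) 0) p := hasFDerivAt_apply 0 p
  have h1 : HasFDerivAt (fun q : Fin 2 → ℝ => q 1) (ContinuousLinearMap.proj (R := ℝ)
      (φ := fun _ : Fin 2 => ℝ) 1) p := hasFDerivAt_apply 1 p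
  have hq := (h0.pow 2).sub h0
  have h := hq.mul h1
  refine h.congr_fderiv ?_
  ext v
  simp [foldA, foldB]
  ring

/-- The vertical-trace band `Ω₁` of the fold datum ("between" made orientation-free). -/
def bandOne : Set (Fin 2 → ℝ) :=
  {q | q 0 ∈ Ioo (0 : ℝ) 1 ∧ ((foldA ![q 0, 0] < q 1 ∧ q 1 < foldA ![q 0, 1 - q 0]) ∨
    (foldA ![q 0, 1 - q 0] < q 1 ∧ q 1 < foldA ![q 0, 0]))}

/-- The horizontal-trace band `Ω₂` of the fold datum. -/
def bandTwo : Set (Fin 2 → ℝ) :=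
  {q | q 0 ∈ Ioo (0 : ℝ) 1 ∧ ((foldB ![0, q 0] < q 1 ∧ q 1 < foldB ![1 - q 0, q 0]) ∨
    (foldB ![1 - q 0, q 0] < q 1 ∧ q 1 < foldB ![0, q 0]))}

/-- The fold profile `h(a) = A(a, 1−a) = (2a−1)(1−a)`. -/
def foldH : ℝ → ℝ := fun a => (2 * a - 1) * (1 - a)

@[simp] theorem foldA_bottom (a : ℝ) : foldA ![a, 0] = 0 := by simp [foldA]
@[simp] theorem foldA_top (a : ℝ) : foldA ![a, 1 - a] = foldH a := by simp [foldA, foldH]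
@[simp] theorem foldB_left (b : ℝ) : foldB ![0, b] = 0 := by simp [foldB]
@[simp] theorem foldB_right (b : ℝ) : foldB ![1 - b, b] = b ^ 2 - b := by simp [foldB]; ring

/-- Transport of a fibred planar set to `ℝ × ℝ`: preimage of `regionBetween` under `finTwoArrow`. -/
theorem preimage_regionBetween (f g : ℝ → ℝ) (s : Set ℝ) :
    (MeasurableEquiv.finTwoArrow : (Fin 2 → ℝ) ≃ᵐ ℝ × ℝ) ⁻¹' regionBetween f g s =
      {q : Fin 2 → ℝ | q 0 ∈ s ∧ f (q 0) < q 1 ∧ q 1 < g (q 0)} := by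
  ext q
  simp [regionBetween, MeasurableEquiv.finTwoArrow_apply]

/-- Area of a fibred planar set `{a ∈ (u,v), f a < y < g a}` with `f ≤ g` continuous. -/
theorem volume_fibred {f g : ℝ → ℝ} {u v : ℝ} (hf : Continuous f) (hg : Continuous g)
    (hfg : ∀ x ∈ Ioo u v, f x ≤ g x) :
    volume {q : Fin 2 → ℝ | q 0 ∈ Ioo u v ∧ f (q 0) < q 1 ∧ q 1 < g (q 0)} =
      ENNReal.ofReal (∫ x in Ioo u v, (g x - f x)) := by
  rw [← preimage_regionBetween,
    (volume_preserving_finTwoArrow ℝ).measure_preimage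
      (measurableSet_regionBetween hf.measurable hg.measurable measurableSet_Ioo).nullMeasurableSet,
    Measure.volume_eq_prod,
    volume_regionBetween_eq_integral (hf.integrableOn_Icc.mono_set Ioo_subset_Icc_self)
      (hg.integrableOn_Icc.mono_set Ioo_subset_Icc_self) measurableSet_Ioo hfg]
  rfl

theorem setIntegral_Ioo_eq_intervalIntegral {f : ℝ → ℝ} {u v : ℝ} (huv : u ≤ v) :
    ∫ x in Ioo u v, f x = ∫ x in u..v, f x := by
  rw [intervalIntegral.integral_of_le huv, integral_Ioc_eq_integral_Ioo]

/-- `∫₀¹ (0 − (b² − b)) db = 1/6`. -/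
theorem integral_bandTwo : ∫ x in (0 : ℝ)..1, ((0 : ℝ) - (x ^ 2 - x)) = 1 / 6 := by
  have h : ∀ x ∈ uIcc (0 : ℝ) 1,
      HasDerivAt (fun x : ℝ => x ^ 2 / 2 - x ^ 3 / 3) ((0 : ℝ) - (x ^ 2 - x)) x := by
    intro x _
    have := ((hasDerivAt_pow 2 x).div_const 2).sub ((hasDerivAt_pow 3 x).div_const 3)
    refine this.congr_deriv ?_
    simp only [Nat.reduceSub, pow_one, Nat.cast_ofNat]
    ring
  rw [intervalIntegral.integral_eq_sub_of_hasDerivAt h ((by fun_prop : Continuous fun x : ℝ =>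
    (0 : ℝ) - (x ^ 2 - x)).intervalIntegrable _ _)]
  norm_num

/-- `∫_{½}^1 (2a−1)(1−a) da = 1/24` (the positive sheet). -/
theorem integral_bandOne_pos : ∫ x in (1 / 2 : ℝ)..1, (foldH x - 0) = 1 / 24 := by
  have h : ∀ x ∈ uIcc (1 / 2 : ℝ) 1,
      HasDerivAt (fun x : ℝ => -(2 / 3) * x ^ 3 + (3 / 2) * x ^ 2 - x) (foldH x - 0) x := by
    intro x _
    have := ((((hasDerivAt_pow 3 x).const_mul (-(2 / 3) : ℝ)).add
      ((hasDerivAt_pow 2 x).const_mul (3 / 2 : ℝ))).sub (hasDerivAt_id x))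
    refine this.congr_deriv ?_
    simp only [Nat.reduceSub, pow_one, Nat.cast_ofNat, foldH]
    ring
  rw [intervalIntegral.integral_eq_sub_of_hasDerivAt h ((by unfold foldH; fun_prop : Continuous fun x : ℝ =>
    foldH x - 0).intervalIntegrable _ _)]
  norm_num

/-- `∫₀^{½} (0 − (2a−1)(1−a)) da = 5/24` (the folded sheet). -/
theorem integral_bandOne_neg : ∫ x in (0 : ℝ)..(1 / 2), ((0 : ℝ) - foldH x) = 5 / 24 := by
  have h : ∀ x ∈ uIcc (0 : ℝ) (1 / 2),
      HasDerivAt (fun x : ℝ => (2 / 3) * x ^ 3 - (3 / 2) * x ^ 2 + x) ((0 : ℝ) - foldH x) x := by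
    intro x _
    have := ((((hasDerivAt_pow 3 x).const_mul (2 / 3 : ℝ)).sub
      ((hasDerivAt_pow 2 x).const_mul (3 / 2 : ℝ))).add (hasDerivAt_id x))
    refine this.congr_deriv ?_
    simp only [Nat.reduceSub, pow_one, Nat.cast_ofNat, foldH]
    ring
  rw [intervalIntegral.integral_eq_sub_of_hasDerivAt h ((by unfold foldH; fun_prop : Continuous fun x : ℝ =>
    (0 : ℝ) - foldH x).intervalIntegrable _ _)]
  norm_num

theorem continuous_foldH : Continuous foldH := by unfold foldH; fun_prop

/-- `bandTwo = {b ∈ (0,1), b² − b < w < 0}` (the first disjunct is empty on `(0,1)`). -/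
theorem bandTwo_eq : bandTwo = {q : Fin 2 → ℝ | q 0 ∈ Ioo (0 : ℝ) 1 ∧
    (fun x : ℝ => x ^ 2 - x) (q 0) < q 1 ∧ q 1 < (fun _ : ℝ => (0 : ℝ)) (q 0)} := by
  ext q
  simp only [bandTwo, mem_setOf_eq, foldB_left, foldB_right, mem_Ioo]
  constructor
  · rintro ⟨hq, h | h⟩
    · exfalso; nlinarith [h.1, h.2, hq.1, hq.2]
    · exact ⟨hq, h.1, h.2⟩
  · rintro ⟨hq, h1, h2⟩
    exact ⟨hq, Or.inr ⟨h1, h2⟩⟩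

theorem volume_bandTwo : volume bandTwo = ENNReal.ofReal (1 / 6) := by
  rw [bandTwo_eq, volume_fibred (f := fun x : ℝ => x ^ 2 - x) (g := fun _ : ℝ => (0 : ℝ)) (u := 0) (v := 1)
    (by fun_prop) (by fun_prop) (fun x hx => by nlinarith [hx.1, hx.2]),
    setIntegral_Ioo_eq_intervalIntegral zero_le_one, integral_bandTwo]

/-- `bandOne` splits along `a = ½` into the positive sheet and the folded sheet. -/
theorem bandOne_eq : bandOne =
    {q : Fin 2 → ℝ | q 0 ∈ Ioo (1 / 2 : ℝ) 1 ∧ (fun _ : ℝ => (0 : ℝ)) (q 0) < q 1 ∧ q 1 < foldH (q 0)} ∪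
    {q : Fin 2 → ℝ | q 0 ∈ Ioo (0 : ℝ) (1 / 2) ∧ foldH (q 0) < q 1 ∧ q 1 < (fun _ : ℝ => (0 : ℝ)) (q 0)} := by
  ext q
  simp only [bandOne, mem_setOf_eq, foldA_bottom, foldA_top, mem_Ioo, mem_union, foldH]
  constructor
  · rintro ⟨hq, h | h⟩
    · left
      refine ⟨⟨?_, hq.2⟩, h.1, h.2⟩
      nlinarith [h.1, h.2, hq.1, hq.2]
    · right
      refine ⟨⟨hq.1, ?_⟩, h.1, h.2⟩
      nlinarith [h.1, h.2, hq.1, hq.2]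
  · rintro (⟨hq, h1, h2⟩ | ⟨hq, h1, h2⟩)
    · exact ⟨⟨by linarith [hq.1], hq.2⟩, Or.inl ⟨h1, h2⟩⟩
    · exact ⟨⟨hq.1, by linarith [hq.2]⟩, Or.inr ⟨h1, h2⟩⟩

theorem volume_bandOne : volume bandOne = ENNReal.ofReal (1 / 4) := by
  have hpos : ∀ x ∈ Ioo (1 / 2 : ℝ) 1, (fun _ : ℝ => (0 : ℝ)) x ≤ foldH x := fun x hx => by
    simp only [foldH]; nlinarith [hx.1, hx.2]
  have hneg : ∀ x ∈ Ioo (0 : ℝ) (1 / 2), foldH x ≤ (fun _ : ℝ => (0 : ℝ)) x := fun x hx => by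
    simp only [foldH]; nlinarith [hx.1, hx.2]
  rw [bandOne_eq, measure_union]
  · rw [volume_fibred (f := fun _ : ℝ => (0 : ℝ)) (g := foldH) (u := 1 / 2) (v := 1) (by fun_prop)
        continuous_foldH hpos,
      volume_fibred (f := foldH) (g := fun _ : ℝ => (0 : ℝ)) (u := 0) (v := 1 / 2) continuous_foldH
        (by fun_prop) hneg,
      setIntegral_Ioo_eq_intervalIntegral (by norm_num), setIntegral_Ioo_eq_intervalIntegral (by norm_num),
      integral_bandOne_pos, integral_bandOne_neg, ← ENNReal.ofReal_add (by norm_num) (by norm_num)]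
    norm_num
  · rw [Set.disjoint_left]
    rintro q ⟨hq, -, -⟩ ⟨hq', -, -⟩
    linarith [hq.1, hq'.2]
  · -- measurability of the folded sheet
    rw [← preimage_regionBetween foldH (fun _ : ℝ => (0 : ℝ)) (Ioo (0 : ℝ) (1 / 2))]
    exact (measurableSet_regionBetween continuous_foldH.measurable measurable_const
      measurableSet_Ioo).preimage MeasurableEquiv.finTwoArrow.measurable

theorem isSemialgebraic_bandOne : IsSemialgebraic ℚ bandOne := by
  -- bandOne = {0 < a < 1} ∩ ({0 < y ∧ y < h} ∪ {h < y ∧ y < 0}), all polynomial inequalities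
  let P : MvPolynomial (Fin 2) ℚ := (C 2 * X 0 - C 1) * (C 1 - X 0)
  have hP : ∀ q : Fin 2 → ℝ, aeval q P = foldH (q 0) := by intro q; simp [P, foldH]
  have h := ((isSemialgebraic_setOf_eval_lt (k := ℚ) (R := ℝ) (ι := Fin 2) (C 0) (X 0)).inter
    (isSemialgebraic_setOf_eval_lt (k := ℚ) (R := ℝ) (ι := Fin 2) (X 0) (C 1))).inter
    (((isSemialgebraic_setOf_eval_lt (k := ℚ) (R := ℝ) (ι := Fin 2) (C 0) (X 1)).inter
      (isSemialgebraic_setOf_eval_lt (k := ℚ) (R := ℝ) (ι := Fin 2) (X 1) P)).union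
     ((isSemialgebraic_setOf_eval_lt (k := ℚ) (R := ℝ) (ι := Fin 2) P (X 1)).inter
      (isSemialgebraic_setOf_eval_lt (k := ℚ) (R := ℝ) (ι := Fin 2) (X 1) (C 0))))
  have key : ∀ S' : Set (Fin 2 → ℝ), IsSemialgebraic ℚ S' → bandOne = S' → IsSemialgebraic ℚ bandOne := by
    rintro S' hS rfl; exact hS
  refine key _ h ?_
  ext q
  simp only [bandOne, mem_setOf_eq, foldA_bottom, foldA_top, mem_Ioo, mem_inter_iff, mem_union, hP,
    map_zero, map_one, aeval_X]

theorem isSemialgebraic_bandTwo : IsSemialgebraic ℚ bandTwo := by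
  let P : MvPolynomial (Fin 2) ℚ := X 0 ^ 2 - X 0
  have hP : ∀ q : Fin 2 → ℝ, aeval q P = q 0 ^ 2 - q 0 := by intro q; simp [P]
  have h := ((isSemialgebraic_setOf_eval_lt (k := ℚ) (R := ℝ) (ι := Fin 2) (C 0) (X 0)).inter
    (isSemialgebraic_setOf_eval_lt (k := ℚ) (R := ℝ) (ι := Fin 2) (X 0) (C 1))).inter
    (((isSemialgebraic_setOf_eval_lt (k := ℚ) (R := ℝ) (ι := Fin 2) (C 0) (X 1)).inter
      (isSemialgebraic_setOf_eval_lt (k := ℚ) (R := ℝ) (ι := Fin 2) (X 1) P)).union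
     ((isSemialgebraic_setOf_eval_lt (k := ℚ) (R := ℝ) (ι := Fin 2) P (X 1)).inter
      (isSemialgebraic_setOf_eval_lt (k := ℚ) (R := ℝ) (ι := Fin 2) (X 1) (C 0))))
  have key : ∀ S' : Set (Fin 2 → ℝ), IsSemialgebraic ℚ S' → bandTwo = S' → IsSemialgebraic ℚ bandTwo := by
    rintro S' hS rfl; exact hS
  refine key _ h ?_
  ext q
  simp only [bandTwo, mem_setOf_eq, foldB_left, foldB_right, mem_Ioo, mem_inter_iff, mem_union, hP,
    map_zero, map_one, aeval_X]

theorem volume_bandOne_lt_top : volume bandOne < ⊤ := by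
  rw [volume_bandOne]; exact ENNReal.ofReal_lt_top
theorem volume_bandTwo_lt_top : volume bandTwo < ⊤ := by
  rw [volume_bandTwo]; exact ENNReal.ofReal_lt_top

/-- `[Ω₁, 1]`. -/
def bandOneRep : KZ.IntegralRep 2 where
  domain := bandOne
  integrand := fun _ => 1
  isSemialgebraic_domain := isSemialgebraic_bandOne
  isSemialgebraicFunOn_integrand := isSemialgebraicFunOn_one isSemialgebraic_bandOne
  integrableOn := integrableOn_const volume_bandOne_lt_top.ne

/-- `[Ω₂, 1]`. -/
def bandTwoRep : KZ.IntegralRep 2 where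
  domain := bandTwo
  integrand := fun _ => 1
  isSemialgebraic_domain := isSemialgebraic_bandTwo
  isSemialgebraicFunOn_integrand := isSemialgebraicFunOn_one isSemialgebraic_bandTwo
  integrableOn := integrableOn_const volume_bandTwo_lt_top.ne

theorem value_bandOneRep : bandOneRep.value = 1 / 4 := by
  rw [value_of_integrand_one _ rfl, show bandOneRep.domain = bandOne from rfl, volume_bandOne,
    ENNReal.toReal_ofReal (by norm_num)]

theorem value_bandTwoRep : bandTwoRep.value = 1 / 6 := by
  rw [value_of_integrand_one _ rfl, show bandTwoRep.domain = bandTwo from rfl, volume_bandTwo,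
    ENNReal.toReal_ofReal (by norm_num)]

/-- NAIVE GREEN BANDS: for Green data as typed in the crux, the band of vertical traces and the
band of horizontal traces are KZ-equivalent (weakest conceivable form of "Green ↦ transport of the
two bands" without subdivision by the sign of the twist). -/
def NaiveGreenBands : Prop :=
  ∀ (A B S : (Fin 2 → ℝ) → ℝ), IsSemialgebraicFunOn ℚ triangle A → IsSemialgebraicFunOn ℚ triangle B →
    ContinuousOn A triangle → ContinuousOn B triangle →
    (∀ p : Fin 2 → ℝ, 0 < p 0 → 0 < p 1 → p 0 + p 1 < 1 →
      HasFDerivAt S (A p • ContinuousLinearMap.proj (R := ℝ) (φ := fun _ : Fin 2 => ℝ) 0 +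
        B p • ContinuousLinearMap.proj (R := ℝ) (φ := fun _ : Fin 2 => ℝ) 1) p) →
    ∀ r r' : KZ.IntegralRep 2,
      r.domain = {q | q 0 ∈ Ioo (0 : ℝ) 1 ∧ ((A ![q 0, 0] < q 1 ∧ q 1 < A ![q 0, 1 - q 0]) ∨
        (A ![q 0, 1 - q 0] < q 1 ∧ q 1 < A ![q 0, 0]))} →
      r'.domain = {q | q 0 ∈ Ioo (0 : ℝ) 1 ∧ ((B ![0, q 0] < q 1 ∧ q 1 < B ![1 - q 0, q 0]) ∨
        (B ![1 - q 0, q 0] < q 1 ∧ q 1 < B ![0, q 0]))} →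
      (∀ p ∈ r.domain, r.integrand p = 1) → (∀ p ∈ r'.domain, r'.integrand p = 1) →
      KZ.Equivalent r r'

/-- THE FOLD IS REAL: `NaiveGreenBands` is false — for `S = (a² − a)b` the two bands have areas
`1/4 ≠ 1/6` (soundness of the whole KZ calculus, `KZ.Equivalent.value_eq_holds`). A fortiori no
planar chain and no single rule-2 instance relates them. -/
theorem not_naiveGreenBands : ¬ NaiveGreenBands := by
  intro h
  have hEq := h foldA foldB foldS isSemialgebraicFunOn_foldA isSemialgebraicFunOn_foldB
    continuous_foldA.continuousOn continuous_foldB.continuousOn (fun p _ _ _ => hasFDerivAt_foldS p)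
    bandOneRep bandTwoRep rfl rfl (fun _ _ => rfl) (fun _ _ => rfl)
  have hv := KZ.Equivalent.value_eq_holds hEq
  rw [value_bandOneRep, value_bandTwoRep] at hv
  norm_num at hv

/-- … while the SIGNED identity behind the Green generator holds for the same datum:
`∫₀¹ A(t,0) dt + ∫₀¹ (B − A)(1−t,t) dt − ∫₀¹ B(0,t) dt = 0 + (1/6 − (−1/6)) … = 0`, here in the form
`∫₀¹ h = −1/6 = −∫₀¹ (b − b²)`: the folded sheet must be counted negatively. -/
theorem fold_signed_identity :
    ∫ x in (0 : ℝ)..1, foldH x = -(1 / 6) ∧ ∫ x in (0 : ℝ)..1, (x ^ 2 - x) = -(1 / 6) := by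
  constructor
  · have h : ∀ x ∈ uIcc (0 : ℝ) 1,
        HasDerivAt (fun x : ℝ => -(2 / 3) * x ^ 3 + (3 / 2) * x ^ 2 - x) (foldH x) x := by
      intro x _
      have := ((((hasDerivAt_pow 3 x).const_mul (-(2 / 3) : ℝ)).add
        ((hasDerivAt_pow 2 x).const_mul (3 / 2 : ℝ))).sub (hasDerivAt_id x))
      refine this.congr_deriv ?_
      simp only [Nat.reduceSub, pow_one, Nat.cast_ofNat, foldH]
      ring
    rw [intervalIntegral.integral_eq_sub_of_hasDerivAt h (continuous_foldH.intervalIntegrable _ _)]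
    norm_num
  · norm_num [integral_pow, integral_id, intervalIntegral.integral_sub]



/-! # CYCLE 2 (gen 2, 2026-08-16) — §6 the engine's hypotheses are load-bearing, §7 a sign cell can fold

Written against the PICKED line `twist-restoring-shear` (lead skeleton `Lines/twist-restoring-shear.lean`,
sha a84852d9: `λ = 0`, stubs cellCompiler / normalForm / elementaryMoves / shearedTransport / signedSweep /
band / greenAssembly; and the crux-planner's registered variants f9f84b9a / v2). Landed copies:
`Theorems/PlanarCompiler/Negative/EngineClosedness.lean`, `EngineInjectivity.lean`, `SignCell.lean`
(namespace `…SymplecticScissors.PlanarCompilerNegative`). The statements below quote the stub shapes of the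
registered skeleton f9f84b9a (with the twist parameter `lam : ℚ`); at `lam = 0` they are the lead's. -/
/-! ## §6.0 Common kit: soundness of one rule-2 instance, derivatives of the polynomial data -/

/-- Rule 2 is sound between two representations: a single `changeOfVariablesRel` membership forces
equal values (`KZ.eval_eq_zero_of_mem_changeOfVariablesRel_holds`). [folklore] -/
theorem value_eq_of_sub_mem_cov {r r' : KZ.IntegralRep 2}
    (h : KZ.of r - KZ.of r' ∈ KZ.changeOfVariablesRel) : r.value = r'.value := by
  have h0 := KZ.eval_eq_zero_of_mem_changeOfVariablesRel_holds h
  rwa [map_sub, KZ.eval_of, KZ.eval_of, sub_eq_zero] at h0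

/-- The open unit square `(0,1)²` of the kit as a set. [folklore] -/
theorem mem_unitBox {p : Fin 2 → ℝ} :
    p ∈ (boxRep ![0, 0] ![1, 1]).domain ↔ (0 < p 0 ∧ p 0 < 1) ∧ (0 < p 1 ∧ p 1 < 1) := by
  rw [boxRep_domain, mem_box, Fin.forall_fin_two]
  simp

/-- `fderiv` of the linear datum `A = 2b` in the direction `e₁` is `2`. [folklore] -/
theorem fderiv_two_mul_snd (p : Fin 2 → ℝ) :
    fderiv ℝ (fun q : Fin 2 → ℝ => 2 * q 1) p (Pi.single 1 1) = 2 := by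
  have h : HasFDerivAt (fun q : Fin 2 → ℝ => 2 * q 1)
      ((2 : ℝ) • ContinuousLinearMap.proj (R := ℝ) (φ := fun _ : Fin 2 => ℝ) 1) p :=
    (hasFDerivAt_apply 1 p).const_mul 2
  rw [h.fderiv]
  simp

/-! ## §6.1 Closedness `∂_b A = ∂_a B` is load-bearing

Datum: `U = (0,1)²`, `A = 2b`, `B = a`, `λ = 0` (so `∂_bA = 2 ≠ 1 = ∂_aB`): both sheared
projections `(a, 2b)` and `(b, a)` are injective, the twist `λ + ∂_bA = 2` never vanishes, and the
swept regions are `(0,1) × (0,2)` (area `2`) and `(0,1)²` (area `1`). -/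

/-- `stub_shearedTransport` of the twist-restoring-shear skeleton with the closedness hypothesis
`∀ p ∈ U, fderiv ℝ A p (Pi.single 1 1) = fderiv ℝ B p (Pi.single 0 1)` DELETED (all else verbatim). -/
def ShearedTransportWithoutClosed : Prop :=
  ∀ (U : Set (Fin 2 → ℝ)) (A B : (Fin 2 → ℝ) → ℝ) (lam : ℚ), IsOpen U → IsSemialgebraic ℚ U →
    IsSemialgebraicFunOn ℚ U A → IsSemialgebraicFunOn ℚ U B → ContDiffOn ℝ 1 A U → ContDiffOn ℝ 1 B U →
    (∀ p ∈ U, (lam : ℝ) + fderiv ℝ A p (Pi.single 1 1) ≠ 0) →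
    Set.InjOn (fun p : Fin 2 → ℝ => (![p 0, A p + (lam : ℝ) * p 1] : Fin 2 → ℝ)) U →
    Set.InjOn (fun p : Fin 2 → ℝ => (![p 1, B p + (lam : ℝ) * p 0] : Fin 2 → ℝ)) U →
    ∀ r r' : KZ.IntegralRep 2,
      r.domain = (fun p : Fin 2 → ℝ => (![p 0, A p + (lam : ℝ) * p 1] : Fin 2 → ℝ)) '' U →
      r'.domain = (fun p : Fin 2 → ℝ => (![p 1, B p + (lam : ℝ) * p 0] : Fin 2 → ℝ)) '' U →
      (∀ q ∈ r.domain, r.integrand q = 1) → (∀ q ∈ r'.domain, r'.integrand q = 1) →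
      KZ.of r - KZ.of r' ∈ KZ.changeOfVariablesRel

/-- The vertical sweep of the non-closed datum carries `(0,1)²` onto `(0,1) × (0,2)`. [folklore] -/
theorem image_sweepA_nonClosed :
    (fun p : Fin 2 → ℝ => (![p 0, 2 * p 1 + ((0 : ℚ) : ℝ) * p 1] : Fin 2 → ℝ)) ''
      (boxRep ![0, 0] ![1, 1]).domain = (boxRep ![0, 0] ![1, 2]).domain := by
  ext q
  simp only [mem_image, boxRep_domain, mem_box, Fin.forall_fin_two, Rat.cast_zero, zero_mul,
    add_zero]
  constructor
  · rintro ⟨p, ⟨h0, h1⟩, rfl⟩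
    simp only [Matrix.cons_val_zero, Matrix.cons_val_one] at h0 h1 ⊢
    push_cast at h0 h1 ⊢
    exact ⟨h0, by constructor <;> linarith [h1.1, h1.2]⟩
  · rintro ⟨h0, h1⟩
    simp only [Matrix.cons_val_zero, Matrix.cons_val_one] at h0 h1
    push_cast at h0 h1
    refine ⟨![q 0, q 1 / 2], ?_, ?_⟩
    · simp only [Matrix.cons_val_zero, Matrix.cons_val_one]
      push_cast
      exact ⟨h0, by constructor <;> linarith [h1.1, h1.2]⟩
    · ext i
      fin_cases i
      · simp
      · simp; ring

/-- The horizontal sweep of the non-closed datum carries `(0,1)²` onto itself (the swap). [folklore] -/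
theorem image_sweepB_nonClosed :
    (fun p : Fin 2 → ℝ => (![p 1, p 0 + ((0 : ℚ) : ℝ) * p 0] : Fin 2 → ℝ)) ''
      (boxRep ![0, 0] ![1, 1]).domain = (boxRep ![0, 0] ![1, 1]).domain := by
  ext q
  simp only [mem_image, boxRep_domain, mem_box, Fin.forall_fin_two, Rat.cast_zero, zero_mul,
    add_zero]
  constructor
  · rintro ⟨p, ⟨h0, h1⟩, rfl⟩
    simp only [Matrix.cons_val_zero, Matrix.cons_val_one] at h0 h1 ⊢
    exact ⟨h1, h0⟩
  · rintro ⟨h0, h1⟩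
    refine ⟨![q 1, q 0], ?_, ?_⟩
    · simp only [Matrix.cons_val_zero, Matrix.cons_val_one] at h0 h1 ⊢
      exact ⟨h1, h0⟩
    · ext i
      fin_cases i <;> simp

/-- LOAD-BEARING (closedness): `stub_shearedTransport` without `∂_bA = ∂_aB` is FALSE. [folklore] -/
theorem not_shearedTransportWithoutClosed : ¬ ShearedTransportWithoutClosed := by
  intro h
  have hU : IsSemialgebraic ℚ (boxRep ![0, 0] ![1, 1]).domain := (boxRep ![0, 0] ![1, 1]).isSemialgebraic_domain
  have hopen : IsOpen (boxRep ![0, 0] ![1, 1]).domain := by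
    rw [boxRep_domain]; exact isOpen_set_pi finite_univ fun _ _ => isOpen_Ioo
  have hA : IsSemialgebraicFunOn ℚ (boxRep ![0, 0] ![1, 1]).domain (fun q : Fin 2 → ℝ => 2 * q 1) :=
    (isSemialgebraicFunOn_aeval hU (C 2 * X 1)).congr fun p _ => by simp
  have hB : IsSemialgebraicFunOn ℚ (boxRep ![0, 0] ![1, 1]).domain (fun q : Fin 2 → ℝ => q 0) :=
    (isSemialgebraicFunOn_aeval hU (X 0)).congr fun p _ => by simp
  have hcA : ContDiffOn ℝ 1 (fun q : Fin 2 → ℝ => 2 * q 1) (boxRep ![0, 0] ![1, 1]).domain :=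
    (contDiff_const.mul (contDiff_apply ℝ ℝ 1)).contDiffOn
  have hcB : ContDiffOn ℝ 1 (fun q : Fin 2 → ℝ => q 0) (boxRep ![0, 0] ![1, 1]).domain :=
    (contDiff_apply ℝ ℝ 0).contDiffOn
  have htw : ∀ p ∈ (boxRep ![0, 0] ![1, 1]).domain,
      ((0 : ℚ) : ℝ) + fderiv ℝ (fun q : Fin 2 → ℝ => 2 * q 1) p (Pi.single 1 1) ≠ 0 := by
    intro p _
    rw [fderiv_two_mul_snd]
    norm_num
  have hi₁ : Set.InjOn (fun p : Fin 2 → ℝ => (![p 0, 2 * p 1 + ((0 : ℚ) : ℝ) * p 1] : Fin 2 → ℝ))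
      (boxRep ![0, 0] ![1, 1]).domain := by
    intro p _ q _ hpq
    have h0 := congr_fun hpq 0
    have h1 := congr_fun hpq 1
    simp at h0 h1
    ext i; fin_cases i
    · exact h0
    · simpa using h1
  have hi₂ : Set.InjOn (fun p : Fin 2 → ℝ => (![p 1, p 0 + ((0 : ℚ) : ℝ) * p 0] : Fin 2 → ℝ))
      (boxRep ![0, 0] ![1, 1]).domain := by
    intro p _ q _ hpq
    have h0 := congr_fun hpq 0
    have h1 := congr_fun hpq 1
    simp at h0 h1
    ext i; fin_cases i
    · exact h1
    · simpa using h0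
  have hmem := h _ _ _ 0 hopen hU hA hB hcA hcB htw hi₁ hi₂ (boxRep ![0, 0] ![1, 2])
    (boxRep ![0, 0] ![1, 1]) image_sweepA_nonClosed.symm image_sweepB_nonClosed.symm
    (fun _ _ => rfl) (fun _ _ => rfl)
  have hv := value_eq_of_sub_mem_cov hmem
  rw [value_boxRep (by intro i; fin_cases i <;> norm_num),
    value_boxRep (by intro i; fin_cases i <;> norm_num)] at hv
  norm_num [Fin.prod_univ_two] at hv


/-! ## §6.2 Injectivity of each sheared projection is load-bearing

Data: `S = a²b` (`A = 2ab`, `B = a²`, twist `2a`) on the open set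
`U = ((−1,0) ∪ (0,1)) × (0,1)` (twist non-vanishing, `λ = 0`): the vertical sweep `(a, 2ab)` is
injective and sweeps the double wedge `{0<x<1, 0<y<2x} ∪ {−1<x<0, 2x<y<0}` (area `2`), the
horizontal sweep `(b, a²)` FOLDS (`±a`) onto `(0,1)²` (area `1`). The mirror datum `S = ab²` on the
swapped set does the same with the roles of the two sweeps exchanged. -/

/-! ### The double wedge -/

/-- `{0 < x < 1, 0 < y < 2x}`. [folklore] -/
def wedgePos : Set (Fin 2 → ℝ) := {q | q 0 ∈ Ioo (0 : ℝ) 1 ∧ 0 < q 1 ∧ q 1 < 2 * q 0}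

/-- `{−1 < x < 0, 2x < y < 0}`. [folklore] -/
def wedgeNeg : Set (Fin 2 → ℝ) := {q | q 0 ∈ Ioo (-1 : ℝ) 0 ∧ 2 * q 0 < q 1 ∧ q 1 < 0}

/-- The double wedge `wedgePos ∪ wedgeNeg` (area `2`). [folklore] -/
def doubleWedge : Set (Fin 2 → ℝ) := wedgePos ∪ wedgeNeg

/-- Area of the positive wedge: `∫₀¹ 2x dx = 1`. [folklore] -/
theorem volume_wedgePos : volume wedgePos = ENNReal.ofReal 1 := by
  have hi : ∫ x in Ioo (0 : ℝ) 1, ((fun x : ℝ => 2 * x) x - (fun _ : ℝ => (0 : ℝ)) x) = 1 := by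
    rw [setIntegral_Ioo_eq_intervalIntegral zero_le_one]
    simp only [sub_zero]
    rw [intervalIntegral.integral_const_mul, integral_id]
    norm_num
  have h := volume_fibred (f := fun _ : ℝ => (0 : ℝ)) (g := fun x : ℝ => 2 * x) (u := 0)
    (v := 1) (by fun_prop) (by fun_prop) (fun x hx => by linarith [hx.1])
  rw [hi] at h
  exact h

/-- Area of the negative wedge: `∫₋₁⁰ (−2x) dx = 1`. [folklore] -/
theorem volume_wedgeNeg : volume wedgeNeg = ENNReal.ofReal 1 := by
  have hi : ∫ x in Ioo (-1 : ℝ) 0, ((fun _ : ℝ => (0 : ℝ)) x - (fun x : ℝ => 2 * x) x) = 1 := by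
    rw [setIntegral_Ioo_eq_intervalIntegral (by norm_num)]
    have hfun : (fun x : ℝ => (fun _ : ℝ => (0 : ℝ)) x - (fun x : ℝ => 2 * x) x) = fun x => (-2) * x := by
      funext x; simp only; ring
    rw [hfun, intervalIntegral.integral_const_mul, integral_id]
    norm_num
  have h := volume_fibred (f := fun x : ℝ => 2 * x) (g := fun _ : ℝ => (0 : ℝ)) (u := -1)
    (v := 0) (by fun_prop) (by fun_prop) (fun x hx => by linarith [hx.2])
  rw [hi] at h
  exact h

/-- The two wedges are disjoint (sign of the abscissa). [folklore] -/
theorem disjoint_wedges : Disjoint wedgePos wedgeNeg := by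
  rw [Set.disjoint_left]
  rintro q ⟨hq, -, -⟩ ⟨hq', -, -⟩
  linarith [hq.1, hq'.2]

/-- The positive wedge is ℚ-semialgebraic (four polynomial inequalities). [folklore] -/
theorem isSemialgebraic_wedgePos : IsSemialgebraic ℚ wedgePos := by
  have h := ((isSemialgebraic_setOf_eval_lt (k := ℚ) (R := ℝ) (ι := Fin 2) (C 0) (X 0)).inter
    (isSemialgebraic_setOf_eval_lt (k := ℚ) (R := ℝ) (ι := Fin 2) (X 0) (C 1))).inter
    ((isSemialgebraic_setOf_eval_lt (k := ℚ) (R := ℝ) (ι := Fin 2) (C 0) (X 1)).inter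
      (isSemialgebraic_setOf_eval_lt (k := ℚ) (R := ℝ) (ι := Fin 2) (X 1) (C 2 * X 0)))
  have key : ∀ S' : Set (Fin 2 → ℝ), IsSemialgebraic ℚ S' → wedgePos = S' → IsSemialgebraic ℚ wedgePos := by
    rintro S' hS rfl; exact hS
  refine key _ h ?_
  ext q
  simp only [wedgePos, mem_setOf_eq, mem_Ioo, mem_inter_iff, map_zero, map_one, aeval_X, map_mul,
    MvPolynomial.aeval_C, eq_ratCast, Rat.cast_ofNat]

/-- The negative wedge is ℚ-semialgebraic (four polynomial inequalities). [folklore] -/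
theorem isSemialgebraic_wedgeNeg : IsSemialgebraic ℚ wedgeNeg := by
  have h := ((isSemialgebraic_setOf_eval_lt (k := ℚ) (R := ℝ) (ι := Fin 2) (C (-1)) (X 0)).inter
    (isSemialgebraic_setOf_eval_lt (k := ℚ) (R := ℝ) (ι := Fin 2) (X 0) (C 0))).inter
    ((isSemialgebraic_setOf_eval_lt (k := ℚ) (R := ℝ) (ι := Fin 2) (C 2 * X 0) (X 1)).inter
      (isSemialgebraic_setOf_eval_lt (k := ℚ) (R := ℝ) (ι := Fin 2) (X 1) (C 0)))
  have key : ∀ S' : Set (Fin 2 → ℝ), IsSemialgebraic ℚ S' → wedgeNeg = S' → IsSemialgebraic ℚ wedgeNeg := by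
    rintro S' hS rfl; exact hS
  refine key _ h ?_
  ext q
  simp only [wedgeNeg, mem_setOf_eq, mem_Ioo, mem_inter_iff, map_zero, aeval_X, map_mul, map_neg, map_one,
    MvPolynomial.aeval_C, eq_ratCast, Rat.cast_ofNat]

/-- The double wedge is ℚ-semialgebraic. [folklore] -/
theorem isSemialgebraic_doubleWedge : IsSemialgebraic ℚ doubleWedge :=
  isSemialgebraic_wedgePos.union isSemialgebraic_wedgeNeg

/-- Area of the double wedge: `1 + 1 = 2`. [folklore] -/
theorem volume_doubleWedge : volume doubleWedge = ENNReal.ofReal 2 := by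
  rw [doubleWedge, measure_union disjoint_wedges (IsSemialgebraic.measurableSet_holds isSemialgebraic_wedgeNeg),
    volume_wedgePos, volume_wedgeNeg, ← ENNReal.ofReal_add zero_le_one zero_le_one]
  norm_num

/-- `[doubleWedge, 1]`: the double wedge as a planar set (value `2`). [folklore] -/
def doubleWedgeRep : KZ.IntegralRep 2 where
  domain := doubleWedge
  integrand := fun _ => 1
  isSemialgebraic_domain := isSemialgebraic_doubleWedge
  isSemialgebraicFunOn_integrand := isSemialgebraicFunOn_one isSemialgebraic_doubleWedge
  integrableOn := integrableOn_const (by rw [volume_doubleWedge]; exact ENNReal.ofReal_ne_top)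

/-- The double wedge has value `2`. [folklore] -/
theorem value_doubleWedgeRep : doubleWedgeRep.value = 2 := by
  rw [KZ.IntegralRep.value, show doubleWedgeRep.integrand = fun _ => (1 : ℝ) from rfl, setIntegral_const,
    smul_eq_mul, mul_one, measureReal_def, show doubleWedgeRep.domain = doubleWedge from rfl,
    volume_doubleWedge, ENNReal.toReal_ofReal zero_le_two]

/-! ### The two open parameter sets and the polynomial data -/

/-- `U = ((−1,0) ∪ (0,1)) × (0,1)`. [folklore] -/
def slitA : Set (Fin 2 → ℝ) :=
  ({p | p 0 ∈ Ioo ((-1 : ℚ) : ℝ) (0 : ℚ)} ∪ {p | p 0 ∈ Ioo ((0 : ℚ) : ℝ) (1 : ℚ)}) ∩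
    {p | p 1 ∈ Ioo ((0 : ℚ) : ℝ) (1 : ℚ)}

/-- `U' = (0,1) × ((−1,0) ∪ (0,1))`. [folklore] -/
def slitB : Set (Fin 2 → ℝ) :=
  {p | p 0 ∈ Ioo ((0 : ℚ) : ℝ) (1 : ℚ)} ∩
    ({p | p 1 ∈ Ioo ((-1 : ℚ) : ℝ) (0 : ℚ)} ∪ {p | p 1 ∈ Ioo ((0 : ℚ) : ℝ) (1 : ℚ)})

/-- Membership in `U = ((−1,0) ∪ (0,1)) × (0,1)`. [folklore] -/
theorem mem_slitA {p : Fin 2 → ℝ} :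
    p ∈ slitA ↔ ((-1 < p 0 ∧ p 0 < 0) ∨ (0 < p 0 ∧ p 0 < 1)) ∧ (0 < p 1 ∧ p 1 < 1) := by
  simp [slitA]

/-- Membership in `U' = (0,1) × ((−1,0) ∪ (0,1))`. [folklore] -/
theorem mem_slitB {p : Fin 2 → ℝ} :
    p ∈ slitB ↔ (0 < p 0 ∧ p 0 < 1) ∧ ((-1 < p 1 ∧ p 1 < 0) ∨ (0 < p 1 ∧ p 1 < 1)) := by
  simp [slitB]

/-- `U` is ℚ-semialgebraic. [folklore] -/
theorem isSemialgebraic_slitA : IsSemialgebraic ℚ slitA :=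
  ((isSemialgebraic_coord_Ioo 0 (-1) 0).union (isSemialgebraic_coord_Ioo 0 0 1)).inter
    (isSemialgebraic_coord_Ioo 1 0 1)

/-- `U'` is ℚ-semialgebraic. [folklore] -/
theorem isSemialgebraic_slitB : IsSemialgebraic ℚ slitB :=
  (isSemialgebraic_coord_Ioo 0 0 1).inter
    ((isSemialgebraic_coord_Ioo 1 (-1) 0).union (isSemialgebraic_coord_Ioo 1 0 1))

/-- `U` is open. [folklore] -/
theorem isOpen_slitA : IsOpen slitA :=
  (((isOpen_Ioo.union isOpen_Ioo).preimage (continuous_apply 0)).inter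
    (isOpen_Ioo.preimage (continuous_apply 1)) : _)

/-- `U'` is open. [folklore] -/
theorem isOpen_slitB : IsOpen slitB :=
  ((isOpen_Ioo.preimage (continuous_apply 0)).inter
    ((isOpen_Ioo.union isOpen_Ioo).preimage (continuous_apply 1)) : _)

/-- `A = 2ab` (the `a`-derivative of `S = a²b`; also the `b`-derivative of `S = ab²`). [folklore] -/
def twoMul : (Fin 2 → ℝ) → ℝ := fun q => 2 * q 0 * q 1
/-- `B = a²`. [folklore] -/
def sqFst : (Fin 2 → ℝ) → ℝ := fun q => q 0 ^ 2
/-- `A' = b²`. [folklore] -/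
def sqSnd : (Fin 2 → ℝ) → ℝ := fun q => q 1 ^ 2

/-- Derivative of `2ab`. [folklore] -/
theorem hasFDerivAt_twoMul (p : Fin 2 → ℝ) :
    HasFDerivAt twoMul ((2 * p 0) • ContinuousLinearMap.proj (R := ℝ) (φ := fun _ : Fin 2 => ℝ) 1 +
      p 1 • ((2 : ℝ) • ContinuousLinearMap.proj (R := ℝ) (φ := fun _ : Fin 2 => ℝ) 0)) p :=
  ((hasFDerivAt_apply 0 p).const_mul 2).mul (hasFDerivAt_apply 1 p)

/-- `∂_b (2ab) = 2a`. [folklore] -/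
theorem fderiv_twoMul_e1 (p : Fin 2 → ℝ) : fderiv ℝ twoMul p (Pi.single 1 1) = 2 * p 0 := by
  rw [(hasFDerivAt_twoMul p).fderiv]; simp

/-- `∂_a (2ab) = 2b`. [folklore] -/
theorem fderiv_twoMul_e0 (p : Fin 2 → ℝ) : fderiv ℝ twoMul p (Pi.single 0 1) = 2 * p 1 := by
  rw [(hasFDerivAt_twoMul p).fderiv]; simp; ring

/-- Derivative of `a²`. [folklore] -/
theorem hasFDerivAt_sqFst (p : Fin 2 → ℝ) :
    HasFDerivAt sqFst ((2 * p 0) • ContinuousLinearMap.proj (R := ℝ) (φ := fun _ : Fin 2 => ℝ) 0) p := by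
  have h := (hasFDerivAt_apply (𝕜 := ℝ) 0 p).pow 2
  refine h.congr_fderiv ?_
  ext v; simp

/-- Derivative of `b²`. [folklore] -/
theorem hasFDerivAt_sqSnd (p : Fin 2 → ℝ) :
    HasFDerivAt sqSnd ((2 * p 1) • ContinuousLinearMap.proj (R := ℝ) (φ := fun _ : Fin 2 => ℝ) 1) p := by
  have h := (hasFDerivAt_apply (𝕜 := ℝ) 1 p).pow 2
  refine h.congr_fderiv ?_
  ext v; simp

/-- `∂_a (a²) = 2a`. [folklore] -/
theorem fderiv_sqFst_e0 (p : Fin 2 → ℝ) : fderiv ℝ sqFst p (Pi.single 0 1) = 2 * p 0 := by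
  rw [(hasFDerivAt_sqFst p).fderiv]; simp

/-- `∂_b (b²) = 2b`. [folklore] -/
theorem fderiv_sqSnd_e1 (p : Fin 2 → ℝ) : fderiv ℝ sqSnd p (Pi.single 1 1) = 2 * p 1 := by
  rw [(hasFDerivAt_sqSnd p).fderiv]; simp

/-- `2ab` is `C¹`. [folklore] -/
theorem contDiff_twoMul : ContDiff ℝ 1 twoMul := by unfold twoMul; fun_prop
/-- `a²` is `C¹`. [folklore] -/
theorem contDiff_sqFst : ContDiff ℝ 1 sqFst := by unfold sqFst; fun_prop
/-- `b²` is `C¹`. [folklore] -/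
theorem contDiff_sqSnd : ContDiff ℝ 1 sqSnd := by unfold sqSnd; fun_prop

/-- `2ab` is a ℚ-semialgebraic function on any ℚ-semialgebraic set. [folklore] -/
theorem isSemialgebraicFunOn_twoMul {s : Set (Fin 2 → ℝ)} (hs : IsSemialgebraic ℚ s) :
    IsSemialgebraicFunOn ℚ s twoMul :=
  (isSemialgebraicFunOn_aeval hs (C 2 * X 0 * X 1)).congr fun p _ => by simp [twoMul]

/-- `a²` is a ℚ-semialgebraic function on any ℚ-semialgebraic set. [folklore] -/
theorem isSemialgebraicFunOn_sqFst {s : Set (Fin 2 → ℝ)} (hs : IsSemialgebraic ℚ s) :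
    IsSemialgebraicFunOn ℚ s sqFst :=
  (isSemialgebraicFunOn_aeval hs (X 0 ^ 2)).congr fun p _ => by simp [sqFst]

/-- `b²` is a ℚ-semialgebraic function on any ℚ-semialgebraic set. [folklore] -/
theorem isSemialgebraicFunOn_sqSnd {s : Set (Fin 2 → ℝ)} (hs : IsSemialgebraic ℚ s) :
    IsSemialgebraicFunOn ℚ s sqSnd :=
  (isSemialgebraicFunOn_aeval hs (X 1 ^ 2)).congr fun p _ => by simp [sqSnd]

/-! ### The four swept regions -/

/-- Vertical sweep of `S = a²b`: `(a, 2ab)` carries `U` onto the double wedge. [folklore] -/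
theorem image_sweepA_twoMul :
    (fun p : Fin 2 → ℝ => (![p 0, twoMul p + ((0 : ℚ) : ℝ) * p 1] : Fin 2 → ℝ)) '' slitA = doubleWedge := by
  ext q
  simp only [mem_image, mem_slitA, doubleWedge, wedgePos, wedgeNeg, mem_union, mem_setOf_eq, mem_Ioo,
    Rat.cast_zero, zero_mul, add_zero, twoMul]
  constructor
  · rintro ⟨p, ⟨h0 | h0, h1⟩, rfl⟩
    · right
      simp only [Matrix.cons_val_zero, Matrix.cons_val_one]
      refine ⟨h0, ?_, ?_⟩ <;> nlinarith [h0.1, h0.2, h1.1, h1.2]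
    · left
      simp only [Matrix.cons_val_zero, Matrix.cons_val_one]
      refine ⟨h0, ?_, ?_⟩ <;> nlinarith [h0.1, h0.2, h1.1, h1.2]
  · rintro (⟨hq0, hq1, hq2⟩ | ⟨hq0, hq1, hq2⟩)
    · have hq : q 0 ≠ 0 := ne_of_gt hq0.1
      refine ⟨![q 0, q 1 / (2 * q 0)], ⟨Or.inr (by simpa using hq0), ?_⟩, ?_⟩
      · simp only [Matrix.cons_val_one]
        exact ⟨div_pos hq1 (by linarith [hq0.1]), (div_lt_one (by linarith [hq0.1])).mpr hq2⟩
      · ext i; fin_cases i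
        · simp
        · simp; field_simp
    · have hneg : (2 : ℝ) * q 0 < 0 := by linarith [hq0.2]
      have hq : q 0 ≠ 0 := ne_of_lt hq0.2
      refine ⟨![q 0, q 1 / (2 * q 0)], ⟨Or.inl (by simpa using hq0), ?_⟩, ?_⟩
      · simp only [Matrix.cons_val_one]
        exact ⟨div_pos_of_neg_of_neg hq2 hneg, (div_lt_one_of_neg hneg).mpr hq1⟩
      · ext i; fin_cases i
        · simp
        · simp; field_simp

/-- Horizontal sweep of `S = a²b`: `(b, a²)` FOLDS `U` onto `(0,1)²`. [folklore] -/
theorem image_sweepB_sqFst :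
    (fun p : Fin 2 → ℝ => (![p 1, sqFst p + ((0 : ℚ) : ℝ) * p 0] : Fin 2 → ℝ)) '' slitA =
      (boxRep ![0, 0] ![1, 1]).domain := by
  ext q
  simp only [mem_image, mem_slitA, mem_unitBox, Rat.cast_zero, zero_mul, add_zero, sqFst]
  constructor
  · rintro ⟨p, ⟨h0, h1⟩, rfl⟩
    simp only [Matrix.cons_val_zero, Matrix.cons_val_one]
    refine ⟨h1, ?_, ?_⟩
    · rcases h0 with h0 | h0 <;> nlinarith [h0.1, h0.2]
    · rcases h0 with h0 | h0 <;> nlinarith [h0.1, h0.2]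
  · rintro ⟨hq0, hq1⟩
    refine ⟨![Real.sqrt (q 1), q 0], ⟨Or.inr ⟨Real.sqrt_pos.mpr hq1.1, ?_⟩, by simpa using hq0⟩, ?_⟩
    · show Real.sqrt (q 1) < 1
      rw [Real.sqrt_lt' one_pos]; simpa using hq1.2
    · ext i; fin_cases i
      · simp
      · simp [Real.sq_sqrt hq1.1.le]

/-- Vertical sweep of `S = ab²`: `(a, b²)` FOLDS `U'` onto `(0,1)²`. [folklore] -/
theorem image_sweepA_sqSnd :
    (fun p : Fin 2 → ℝ => (![p 0, sqSnd p + ((0 : ℚ) : ℝ) * p 1] : Fin 2 → ℝ)) '' slitB =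
      (boxRep ![0, 0] ![1, 1]).domain := by
  ext q
  simp only [mem_image, mem_slitB, mem_unitBox, Rat.cast_zero, zero_mul, add_zero, sqSnd]
  constructor
  · rintro ⟨p, ⟨h0, h1⟩, rfl⟩
    simp only [Matrix.cons_val_zero, Matrix.cons_val_one]
    refine ⟨h0, ?_, ?_⟩
    · rcases h1 with h1 | h1 <;> nlinarith [h1.1, h1.2]
    · rcases h1 with h1 | h1 <;> nlinarith [h1.1, h1.2]
  · rintro ⟨hq0, hq1⟩
    refine ⟨![q 0, Real.sqrt (q 1)], ⟨by simpa using hq0, Or.inr ⟨Real.sqrt_pos.mpr hq1.1, ?_⟩⟩, ?_⟩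
    · show Real.sqrt (q 1) < 1
      rw [Real.sqrt_lt' one_pos]; simpa using hq1.2
    · ext i; fin_cases i
      · simp
      · simp [Real.sq_sqrt hq1.1.le]

/-- Horizontal sweep of `S = ab²`: `(b, 2ab)` carries `U'` onto the double wedge. [folklore] -/
theorem image_sweepB_twoMul :
    (fun p : Fin 2 → ℝ => (![p 1, twoMul p + ((0 : ℚ) : ℝ) * p 0] : Fin 2 → ℝ)) '' slitB = doubleWedge := by
  ext q
  simp only [mem_image, mem_slitB, doubleWedge, wedgePos, wedgeNeg, mem_union, mem_setOf_eq, mem_Ioo,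
    Rat.cast_zero, zero_mul, add_zero, twoMul]
  constructor
  · rintro ⟨p, ⟨h0, h1 | h1⟩, rfl⟩
    · right
      simp only [Matrix.cons_val_zero, Matrix.cons_val_one]
      refine ⟨h1, ?_, ?_⟩ <;> nlinarith [h0.1, h0.2, h1.1, h1.2]
    · left
      simp only [Matrix.cons_val_zero, Matrix.cons_val_one]
      refine ⟨h1, ?_, ?_⟩ <;> nlinarith [h0.1, h0.2, h1.1, h1.2]
  · rintro (⟨hq0, hq1, hq2⟩ | ⟨hq0, hq1, hq2⟩)
    · have hq : q 0 ≠ 0 := ne_of_gt hq0.1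
      refine ⟨![q 1 / (2 * q 0), q 0], ⟨?_, Or.inr (by simpa using hq0)⟩, ?_⟩
      · show 0 < q 1 / (2 * q 0) ∧ q 1 / (2 * q 0) < 1
        exact ⟨div_pos hq1 (by linarith [hq0.1]), (div_lt_one (by linarith [hq0.1])).mpr hq2⟩
      · ext i; fin_cases i
        · simp
        · simp; field_simp
    · have hneg : (2 : ℝ) * q 0 < 0 := by linarith [hq0.2]
      have hq : q 0 ≠ 0 := ne_of_lt hq0.2
      refine ⟨![q 1 / (2 * q 0), q 0], ⟨?_, Or.inl (by simpa using hq0)⟩, ?_⟩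
      · show 0 < q 1 / (2 * q 0) ∧ q 1 / (2 * q 0) < 1
        exact ⟨div_pos_of_neg_of_neg hq2 hneg, (div_lt_one_of_neg hneg).mpr hq1⟩
      · ext i; fin_cases i
        · simp
        · simp; field_simp

/-! ### The two hypothesis-dropped stubs and their refutations -/

/-- `stub_shearedTransport` with the hypothesis `Set.InjOn Ψ₂ U` (injectivity of the horizontal
sweep `(b, B + λa)`) DELETED, all else verbatim. -/
def ShearedTransportWithoutInj₂ : Prop :=
  ∀ (U : Set (Fin 2 → ℝ)) (A B : (Fin 2 → ℝ) → ℝ) (lam : ℚ), IsOpen U → IsSemialgebraic ℚ U →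
    IsSemialgebraicFunOn ℚ U A → IsSemialgebraicFunOn ℚ U B → ContDiffOn ℝ 1 A U → ContDiffOn ℝ 1 B U →
    (∀ p ∈ U, fderiv ℝ A p (Pi.single 1 1) = fderiv ℝ B p (Pi.single 0 1)) →
    (∀ p ∈ U, (lam : ℝ) + fderiv ℝ A p (Pi.single 1 1) ≠ 0) →
    Set.InjOn (fun p : Fin 2 → ℝ => (![p 0, A p + (lam : ℝ) * p 1] : Fin 2 → ℝ)) U →
    ∀ r r' : KZ.IntegralRep 2,
      r.domain = (fun p : Fin 2 → ℝ => (![p 0, A p + (lam : ℝ) * p 1] : Fin 2 → ℝ)) '' U →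
      r'.domain = (fun p : Fin 2 → ℝ => (![p 1, B p + (lam : ℝ) * p 0] : Fin 2 → ℝ)) '' U →
      (∀ q ∈ r.domain, r.integrand q = 1) → (∀ q ∈ r'.domain, r'.integrand q = 1) →
      KZ.of r - KZ.of r' ∈ KZ.changeOfVariablesRel

/-- `stub_shearedTransport` with the hypothesis `Set.InjOn Ψ₁ U` (injectivity of the vertical
sweep `(a, A + λb)`) DELETED, all else verbatim. -/
def ShearedTransportWithoutInj₁ : Prop :=
  ∀ (U : Set (Fin 2 → ℝ)) (A B : (Fin 2 → ℝ) → ℝ) (lam : ℚ), IsOpen U → IsSemialgebraic ℚ U →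
    IsSemialgebraicFunOn ℚ U A → IsSemialgebraicFunOn ℚ U B → ContDiffOn ℝ 1 A U → ContDiffOn ℝ 1 B U →
    (∀ p ∈ U, fderiv ℝ A p (Pi.single 1 1) = fderiv ℝ B p (Pi.single 0 1)) →
    (∀ p ∈ U, (lam : ℝ) + fderiv ℝ A p (Pi.single 1 1) ≠ 0) →
    Set.InjOn (fun p : Fin 2 → ℝ => (![p 1, B p + (lam : ℝ) * p 0] : Fin 2 → ℝ)) U →
    ∀ r r' : KZ.IntegralRep 2,
      r.domain = (fun p : Fin 2 → ℝ => (![p 0, A p + (lam : ℝ) * p 1] : Fin 2 → ℝ)) '' U →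
      r'.domain = (fun p : Fin 2 → ℝ => (![p 1, B p + (lam : ℝ) * p 0] : Fin 2 → ℝ)) '' U →
      (∀ q ∈ r.domain, r.integrand q = 1) → (∀ q ∈ r'.domain, r'.integrand q = 1) →
      KZ.of r - KZ.of r' ∈ KZ.changeOfVariablesRel

/-- LOAD-BEARING (injectivity of the horizontal sweep): `stub_shearedTransport` without
`InjOn Ψ₂ U` is FALSE — datum `S = a²b` on `((−1,0) ∪ (0,1)) × (0,1)`, areas `2 ≠ 1`. [folklore] -/
theorem not_shearedTransportWithoutInj₂ : ¬ ShearedTransportWithoutInj₂ := by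
  intro h
  have htw : ∀ p ∈ slitA, ((0 : ℚ) : ℝ) + fderiv ℝ twoMul p (Pi.single 1 1) ≠ 0 := by
    intro p hp
    rw [fderiv_twoMul_e1, Rat.cast_zero, zero_add]
    rcases (mem_slitA.mp hp).1 with h0 | h0
    · exact fun h' => by linarith [h0.2]
    · exact fun h' => by linarith [h0.1]
  have hcl : ∀ p ∈ slitA, fderiv ℝ twoMul p (Pi.single 1 1) = fderiv ℝ sqFst p (Pi.single 0 1) := by
    intro p _; rw [fderiv_twoMul_e1, fderiv_sqFst_e0]
  have hi₁ : Set.InjOn (fun p : Fin 2 → ℝ => (![p 0, twoMul p + ((0 : ℚ) : ℝ) * p 1] : Fin 2 → ℝ)) slitA := by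
    intro p hp q _ hpq
    have h0 := congr_fun hpq 0
    have h1 := congr_fun hpq 1
    simp only [Matrix.cons_val_zero, Matrix.cons_val_one, Rat.cast_zero, zero_mul, add_zero, twoMul] at h0 h1
    have hp0 : p 0 ≠ 0 := by
      rcases (mem_slitA.mp hp).1 with h | h
      · exact ne_of_lt h.2
      · exact ne_of_gt h.1
    rw [h0] at h1 hp0
    have h1' : p 1 = q 1 := by
      have := mul_left_cancel₀ (mul_ne_zero two_ne_zero hp0) h1
      exact this
    ext i; fin_cases i
    · exact h0
    · exact h1'
  have hmem := h slitA twoMul sqFst 0 isOpen_slitA isSemialgebraic_slitA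
    (isSemialgebraicFunOn_twoMul isSemialgebraic_slitA) (isSemialgebraicFunOn_sqFst isSemialgebraic_slitA)
    contDiff_twoMul.contDiffOn contDiff_sqFst.contDiffOn hcl htw hi₁ doubleWedgeRep (boxRep ![0, 0] ![1, 1])
    image_sweepA_twoMul.symm image_sweepB_sqFst.symm (fun _ _ => rfl) (fun _ _ => rfl)
  have hv := value_eq_of_sub_mem_cov hmem
  rw [value_doubleWedgeRep, value_boxRep (by intro i; fin_cases i <;> norm_num)] at hv
  norm_num [Fin.prod_univ_two] at hv

/-- LOAD-BEARING (injectivity of the vertical sweep): `stub_shearedTransport` without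
`InjOn Ψ₁ U` is FALSE — mirror datum `S = ab²` on `(0,1) × ((−1,0) ∪ (0,1))`, areas `1 ≠ 2`. [folklore] -/
theorem not_shearedTransportWithoutInj₁ : ¬ ShearedTransportWithoutInj₁ := by
  intro h
  have htw : ∀ p ∈ slitB, ((0 : ℚ) : ℝ) + fderiv ℝ sqSnd p (Pi.single 1 1) ≠ 0 := by
    intro p hp
    rw [fderiv_sqSnd_e1, Rat.cast_zero, zero_add]
    rcases (mem_slitB.mp hp).2 with h1 | h1
    · exact fun h' => by linarith [h1.2]
    · exact fun h' => by linarith [h1.1]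
  have hcl : ∀ p ∈ slitB, fderiv ℝ sqSnd p (Pi.single 1 1) = fderiv ℝ twoMul p (Pi.single 0 1) := by
    intro p _; rw [fderiv_sqSnd_e1, fderiv_twoMul_e0]
  have hi₂ : Set.InjOn (fun p : Fin 2 → ℝ => (![p 1, twoMul p + ((0 : ℚ) : ℝ) * p 0] : Fin 2 → ℝ)) slitB := by
    intro p hp q _ hpq
    have h0 := congr_fun hpq 0
    have h1 := congr_fun hpq 1
    simp only [Matrix.cons_val_zero, Matrix.cons_val_one, Rat.cast_zero, zero_mul, add_zero, twoMul] at h0 h1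
    have hp1 : p 1 ≠ 0 := by
      rcases (mem_slitB.mp hp).2 with h | h
      · exact ne_of_lt h.2
      · exact ne_of_gt h.1
    rw [h0] at h1 hp1
    have h1' : p 0 = q 0 := by
      have h2 : 2 * q 1 * p 0 = 2 * q 1 * q 0 := by linarith
      exact mul_left_cancel₀ (mul_ne_zero two_ne_zero hp1) h2
    ext i; fin_cases i
    · exact h1'
    · exact h0
  have hmem := h slitB sqSnd twoMul 0 isOpen_slitB isSemialgebraic_slitB
    (isSemialgebraicFunOn_sqSnd isSemialgebraic_slitB) (isSemialgebraicFunOn_twoMul isSemialgebraic_slitB)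
    contDiff_sqSnd.contDiffOn contDiff_twoMul.contDiffOn hcl htw hi₂ (boxRep ![0, 0] ![1, 1]) doubleWedgeRep
    image_sweepA_sqSnd.symm image_sweepB_twoMul.symm (fun _ _ => rfl) (fun _ _ => rfl)
  have hv := value_eq_of_sub_mem_cov hmem
  rw [value_doubleWedgeRep, value_boxRep (by intro i; fin_cases i <;> norm_num)] at hv
  norm_num [Fin.prod_univ_two] at hv


/-! ## §7.0 The polynomial Green datum with a humped zero-twist curve -/

/-- The zero curve of the twist: `β(a) = −3a² + 3a − 1/2` (a hump, positive on `(½ − √3/6, ½ + √3/6)`). [folklore] -/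
def hump (a : ℝ) : ℝ := -3 * a ^ 2 + 3 * a - 1 / 2

/-- The potential `S = a³b − (3/2)a²b + ab²/2 + ab/2`. [folklore] -/
def cellS : (Fin 2 → ℝ) → ℝ := fun q =>
  q 0 ^ 3 * q 1 - 3 / 2 * (q 0 ^ 2 * q 1) + q 0 * q 1 ^ 2 * (1 / 2) + q 0 * q 1 * (1 / 2)

/-- `A = ∂_aS = 3a²b − 3ab + b²/2 + b/2 = b²/2 − b·β(a)`. [folklore] -/
def cellA : (Fin 2 → ℝ) → ℝ := fun q => 3 * (q 0 ^ 2 * q 1) - 3 * (q 0 * q 1) + q 1 ^ 2 * (1 / 2) + q 1 * (1 / 2)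

/-- `B = ∂_bS = a³ − (3/2)a² + ab + a/2`. [folklore] -/
def cellB : (Fin 2 → ℝ) → ℝ := fun q => q 0 ^ 3 - 3 / 2 * q 0 ^ 2 + q 0 * q 1 + q 0 * (1 / 2)

/-- The twist `τ = ∂_bA = ∂_aB = 3a² − 3a + b + 1/2 = b − β(a)`. [folklore] -/
def twist : (Fin 2 → ℝ) → ℝ := fun q => 3 * q 0 ^ 2 - 3 * q 0 + q 1 + 1 / 2

/-- `τ = b − β(a)`. [folklore] -/
theorem twist_eq (q : Fin 2 → ℝ) : twist q = q 1 - hump (q 0) := by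
  simp only [twist, hump]; ring

/-- `dS = A da + B db` everywhere. [folklore] -/
theorem hasFDerivAt_cellS (p : Fin 2 → ℝ) :
    HasFDerivAt cellS (cellA p • ContinuousLinearMap.proj (R := ℝ) (φ := fun _ : Fin 2 => ℝ) 0 +
      cellB p • ContinuousLinearMap.proj (R := ℝ) (φ := fun _ : Fin 2 => ℝ) 1) p := by
  have h0 : HasFDerivAt (fun q : Fin 2 → ℝ => q 0) (ContinuousLinearMap.proj (R := ℝ)
      (φ := fun _ : Fin 2 => ℝ) 0) p := hasFDerivAt_apply 0 p
  have h1 : HasFDerivAt (fun q : Fin 2 → ℝ => q 1) (ContinuousLinearMap.proj (R := ℝ)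
      (φ := fun _ : Fin 2 => ℝ) 1) p := hasFDerivAt_apply 1 p
  have h := ((((h0.pow 3).mul h1).sub (((h0.pow 2).mul h1).const_mul (3 / 2))).add
    ((h0.mul (h1.pow 2)).mul_const (1 / 2))).add ((h0.mul h1).mul_const (1 / 2))
  refine h.congr_fderiv ?_
  ext v
  simp [cellA, cellB]
  ring

/-- Derivative of `A`. [folklore] -/
theorem hasFDerivAt_cellA (p : Fin 2 → ℝ) :
    HasFDerivAt cellA ((6 * p 0 * p 1 - 3 * p 1) • ContinuousLinearMap.proj (R := ℝ) (φ := fun _ : Fin 2 => ℝ) 0 +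
      twist p • ContinuousLinearMap.proj (R := ℝ) (φ := fun _ : Fin 2 => ℝ) 1) p := by
  have h0 : HasFDerivAt (fun q : Fin 2 → ℝ => q 0) (ContinuousLinearMap.proj (R := ℝ)
      (φ := fun _ : Fin 2 => ℝ) 0) p := hasFDerivAt_apply 0 p
  have h1 : HasFDerivAt (fun q : Fin 2 → ℝ => q 1) (ContinuousLinearMap.proj (R := ℝ)
      (φ := fun _ : Fin 2 => ℝ) 1) p := hasFDerivAt_apply 1 p
  have h := ((((h0.pow 2).mul h1).const_mul 3).sub ((h0.mul h1).const_mul 3)).add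
    ((h1.pow 2).mul_const (1 / 2)) |>.add (h1.mul_const (1 / 2))
  refine h.congr_fderiv ?_
  ext v
  simp [twist]
  ring

/-- Derivative of `B`. [folklore] -/
theorem hasFDerivAt_cellB (p : Fin 2 → ℝ) :
    HasFDerivAt cellB (twist p • ContinuousLinearMap.proj (R := ℝ) (φ := fun _ : Fin 2 => ℝ) 0 +
      p 0 • ContinuousLinearMap.proj (R := ℝ) (φ := fun _ : Fin 2 => ℝ) 1) p := by
  have h0 : HasFDerivAt (fun q : Fin 2 → ℝ => q 0) (ContinuousLinearMap.proj (R := ℝ)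
      (φ := fun _ : Fin 2 => ℝ) 0) p := hasFDerivAt_apply 0 p
  have h1 : HasFDerivAt (fun q : Fin 2 → ℝ => q 1) (ContinuousLinearMap.proj (R := ℝ)
      (φ := fun _ : Fin 2 => ℝ) 1) p := hasFDerivAt_apply 1 p
  have h := (((h0.pow 3).sub ((h0.pow 2).const_mul (3 / 2))).add (h0.mul h1)).add (h0.mul_const (1 / 2))
  refine h.congr_fderiv ?_
  ext v
  simp [twist]
  ring

/-- `∂_bA = τ`. [folklore] -/
theorem fderiv_cellA_e1 (p : Fin 2 → ℝ) : fderiv ℝ cellA p (Pi.single 1 1) = twist p := by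
  rw [(hasFDerivAt_cellA p).fderiv]; simp

/-- `∂_aB = τ`. [folklore] -/
theorem fderiv_cellB_e0 (p : Fin 2 → ℝ) : fderiv ℝ cellB p (Pi.single 0 1) = twist p := by
  rw [(hasFDerivAt_cellB p).fderiv]; simp

/-- `A` is `C¹`. [folklore] -/
theorem contDiff_cellA : ContDiff ℝ 1 cellA := by unfold cellA; fun_prop
/-- `B` is `C¹`. [folklore] -/
theorem contDiff_cellB : ContDiff ℝ 1 cellB := by unfold cellB; fun_prop
/-- `A` is continuous. [folklore] -/
theorem continuous_cellA : Continuous cellA := by unfold cellA; fun_prop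
/-- `B` is continuous. [folklore] -/
theorem continuous_cellB : Continuous cellB := by unfold cellB; fun_prop

/-- `A` is a ℚ-semialgebraic function on the closed triangle (a polynomial over ℚ). [folklore] -/
theorem isSemialgebraicFunOn_cellA : IsSemialgebraicFunOn ℚ triangle cellA := by
  refine (isSemialgebraicFunOn_aeval isSemialgebraic_triangle
    (C 3 * (X 0 ^ 2 * X 1) - C 3 * (X 0 * X 1) + X 1 ^ 2 * C (1 / 2) + X 1 * C (1 / 2))).congr ?_
  intro p _
  simp [cellA]

/-- `B` is a ℚ-semialgebraic function on the closed triangle (a polynomial over ℚ). [folklore] -/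
theorem isSemialgebraicFunOn_cellB : IsSemialgebraicFunOn ℚ triangle cellB := by
  refine (isSemialgebraicFunOn_aeval isSemialgebraic_triangle
    (X 0 ^ 3 - C (3 / 2) * X 0 ^ 2 + X 0 * X 1 + X 0 * C (1 / 2))).congr ?_
  intro p _
  simp [cellB]

/-! ## §7.1 The positive sign cell over the middle interval -/

/-- `½ − √3/6`, the left root of `β`. [folklore] -/
def aMinus : ℝ := 1 / 2 - Real.sqrt 3 / 6
/-- `½ + √3/6`, the right root of `β`. [folklore] -/
def aPlus : ℝ := 1 / 2 + Real.sqrt 3 / 6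

/-- `(√3)² = 3`. [folklore] -/
theorem sq_sqrt_three : Real.sqrt 3 ^ 2 = 3 := Real.sq_sqrt (by norm_num)

/-- `3/2 < √3 < 3`. [folklore] -/
theorem sqrt_three_bounds : 3 / 2 < Real.sqrt 3 ∧ Real.sqrt 3 < 3 := by
  have h := sq_sqrt_three
  have h0 : 0 ≤ Real.sqrt 3 := Real.sqrt_nonneg 3
  constructor <;> nlinarith [h, h0]

/-- `β(a) = 3 (a − a₋)(a₊ − a)`. [folklore] -/
theorem hump_eq (a : ℝ) : hump a = 3 * (a - aMinus) * (aPlus - a) := by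
  unfold hump aMinus aPlus
  linear_combination (-1 / 12 : ℝ) * sq_sqrt_three

/-- `β > 0` on the middle interval. [folklore] -/
theorem hump_pos {a : ℝ} (ha : a ∈ Ioo aMinus aPlus) : 0 < hump a := by
  rw [hump_eq]
  have h1 : 0 < a - aMinus := sub_pos.mpr ha.1
  have h2 : 0 < aPlus - a := sub_pos.mpr ha.2
  positivity

/-- The middle interval lies inside `(0,1)`, with `1/4` and `3/4` inside it. [folklore] -/
theorem aMinus_aPlus_bounds : 0 < aMinus ∧ aMinus < 1 / 4 ∧ 3 / 4 < aPlus ∧ aPlus < 1 := by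
  obtain ⟨h1, h2⟩ := sqrt_three_bounds
  unfold aMinus aPlus
  refine ⟨?_, ?_, ?_, ?_⟩ <;> linarith

/-- `β(a) < 1 − a` everywhere (`3a² − 4a + 3/2 > 0`). [folklore] -/
theorem hump_lt_one_sub (a : ℝ) : hump a < 1 - a := by
  unfold hump; nlinarith [sq_nonneg (a - 2 / 3)]

/-- THE SIGN CELL: the open band over the middle interval between the zero-twist curve `b = β(a)`
and the hypotenuse `b = 1 − a`; it is the cell of the vertical sign-CAD of the open triangle on which
the twist is positive, over that interval. [folklore] -/
def posCell : Set (Fin 2 → ℝ) := {p | p 0 ∈ Ioo aMinus aPlus ∧ hump (p 0) < p 1 ∧ p 1 < 1 - p 0}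

/-- The sign cell lies in the open triangle. [folklore] -/
theorem posCell_subset_openTriangle :
    posCell ⊆ {p : Fin 2 → ℝ | 0 < p 0 ∧ 0 < p 1 ∧ p 0 + p 1 < 1} := by
  rintro p ⟨h0, h1, h2⟩
  obtain ⟨hm, -, -, hp⟩ := aMinus_aPlus_bounds
  exact ⟨by linarith [h0.1], (hump_pos h0).trans h1, by linarith⟩

/-- The twist is positive on the sign cell. [folklore] -/
theorem twist_pos_of_mem_posCell {p : Fin 2 → ℝ} (hp : p ∈ posCell) : 0 < twist p := by
  rw [twist_eq]; linarith [hp.2.1]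

/-- The bottom of the cell is the zero curve of the twist. [folklore] -/
theorem twist_bottom (a : ℝ) : twist ![a, hump a] = 0 := by
  rw [twist_eq]; simp

/-- The vertical sweep `Ψ₁ = (a, A)` IS injective on the sign cell (`A(a,·) = (b − β)²/2 − β²/2` is
strictly increasing for `b > β(a)`). [folklore] -/
theorem injOn_sweepA_posCell : Set.InjOn (fun p : Fin 2 → ℝ => (![p 0, cellA p] : Fin 2 → ℝ)) posCell := by
  intro p hp q hq hpq
  have h0 := congr_fun hpq 0
  have h1 := congr_fun hpq 1
  simp only [Matrix.cons_val_zero, Matrix.cons_val_one] at h0 h1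
  have hb : hump (p 0) < p 1 := hp.2.1
  have hb' : hump (p 0) < q 1 := by rw [h0]; exact hq.2.1
  have hA : ∀ r : Fin 2 → ℝ, cellA r = r 1 ^ 2 / 2 - r 1 * hump (r 0) := by
    intro r; simp only [cellA, hump]; ring
  rw [hA, hA, ← h0] at h1
  have hprod : (p 1 - q 1) * (p 1 + q 1 - 2 * hump (p 0)) = 0 := by linear_combination 2 * h1
  rcases mul_eq_zero.mp hprod with h | h
  · ext i; fin_cases i
    · exact h0
    · simpa [sub_eq_zero] using h
  · exfalso; linarith

/-- The two collision points `(1/4, 3/16)` and `(3/4, 3/16)`. [folklore] -/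
def leftPt : Fin 2 → ℝ := ![1 / 4, 3 / 16]
/-- The two collision points `(1/4, 3/16)` and `(3/4, 3/16)`. [folklore] -/
def rightPt : Fin 2 → ℝ := ![3 / 4, 3 / 16]

/-- `(1/4, 3/16)` lies in the sign cell. [folklore] -/
theorem leftPt_mem : leftPt ∈ posCell := by
  obtain ⟨-, h2, h3, -⟩ := aMinus_aPlus_bounds
  refine ⟨⟨?_, ?_⟩, ?_, ?_⟩ <;> norm_num [leftPt, hump] <;> linarith

/-- `(3/4, 3/16)` lies in the sign cell. [folklore] -/
theorem rightPt_mem : rightPt ∈ posCell := by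
  obtain ⟨-, h2, h3, -⟩ := aMinus_aPlus_bounds
  refine ⟨⟨?_, ?_⟩, ?_, ?_⟩ <;> norm_num [rightPt, hump] <;> linarith

/-- … and they collide under the horizontal sweep `Ψ₂ = (b, B)`: `B = 3/32` at both. [folklore] -/
theorem sweepB_leftPt_eq_rightPt :
    (![leftPt 1, cellB leftPt] : Fin 2 → ℝ) = ![rightPt 1, cellB rightPt] := by
  ext i; fin_cases i <;> norm_num [leftPt, rightPt, cellB]

/-- The two collision points are distinct. [folklore] -/
theorem leftPt_ne_rightPt : leftPt ≠ rightPt := by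
  intro h
  have := congr_fun h 0
  norm_num [leftPt, rightPt] at this

/-- THE TRAP: the horizontal sweep `Ψ₂ = (b, B)` is NOT injective on the sign cell. [folklore] -/
theorem not_injOn_sweepB_posCell :
    ¬ Set.InjOn (fun p : Fin 2 → ℝ => (![p 1, cellB p] : Fin 2 → ℝ)) posCell :=
  fun h => leftPt_ne_rightPt (h leftPt_mem rightPt_mem sweepB_leftPt_eq_rightPt)

/-! ## §7.2 The refuted belief: "twist-positive sign cells need no further refinement" -/

/-- "For Green data as typed in the crux, with `A, B` of class `C¹` and `∂_bA = ∂_aB` on the open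
triangle, and for any open band cell `C = {a ∈ (u,v), g a < b < h a}` of the open triangle bounded
below by the zero curve of the twist (`∂_bA (a, g a) = 0`) and above by the hypotenuse (`h a = 1 − a`)
on which the twist `∂_bA` is positive and the vertical sweep `(a, A)` is injective, the horizontal
sweep `(b, B)` is injective on `C`." — i.e. the cells of the vertical sign-CAD could be fed to the
engine as they are. -/
def PosTwistBandSweepInjective : Prop :=
  ∀ (A B S : (Fin 2 → ℝ) → ℝ) (u v : ℝ) (g h : ℝ → ℝ),
    IsSemialgebraicFunOn ℚ {p : Fin 2 → ℝ | 0 ≤ p 0 ∧ 0 ≤ p 1 ∧ p 0 + p 1 ≤ 1} A →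
    IsSemialgebraicFunOn ℚ {p : Fin 2 → ℝ | 0 ≤ p 0 ∧ 0 ≤ p 1 ∧ p 0 + p 1 ≤ 1} B →
    ContinuousOn A {p : Fin 2 → ℝ | 0 ≤ p 0 ∧ 0 ≤ p 1 ∧ p 0 + p 1 ≤ 1} →
    ContinuousOn B {p : Fin 2 → ℝ | 0 ≤ p 0 ∧ 0 ≤ p 1 ∧ p 0 + p 1 ≤ 1} →
    (∀ p : Fin 2 → ℝ, 0 < p 0 → 0 < p 1 → p 0 + p 1 < 1 →
      HasFDerivAt S (A p • ContinuousLinearMap.proj (R := ℝ) (φ := fun _ : Fin 2 => ℝ) 0 +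
        B p • ContinuousLinearMap.proj (R := ℝ) (φ := fun _ : Fin 2 => ℝ) 1) p) →
    ContDiffOn ℝ 1 A {p : Fin 2 → ℝ | 0 < p 0 ∧ 0 < p 1 ∧ p 0 + p 1 < 1} →
    ContDiffOn ℝ 1 B {p : Fin 2 → ℝ | 0 < p 0 ∧ 0 < p 1 ∧ p 0 + p 1 < 1} →
    (∀ p : Fin 2 → ℝ, 0 < p 0 → 0 < p 1 → p 0 + p 1 < 1 →
      fderiv ℝ A p (Pi.single 1 1) = fderiv ℝ B p (Pi.single 0 1)) →
    u < v → ContinuousOn g (Icc u v) → ContinuousOn h (Icc u v) → (∀ a ∈ Ioo u v, g a < h a) →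
    {p : Fin 2 → ℝ | p 0 ∈ Ioo u v ∧ g (p 0) < p 1 ∧ p 1 < h (p 0)} ⊆
      {p : Fin 2 → ℝ | 0 < p 0 ∧ 0 < p 1 ∧ p 0 + p 1 < 1} →
    (∀ a ∈ Ioo u v, fderiv ℝ A ![a, g a] (Pi.single 1 1) = 0) → (∀ a ∈ Ioo u v, h a = 1 - a) →
    (∀ p : Fin 2 → ℝ, p 0 ∈ Ioo u v → g (p 0) < p 1 → p 1 < h (p 0) → 0 < fderiv ℝ A p (Pi.single 1 1)) →
    Set.InjOn (fun p : Fin 2 → ℝ => (![p 0, A p] : Fin 2 → ℝ))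
      {p : Fin 2 → ℝ | p 0 ∈ Ioo u v ∧ g (p 0) < p 1 ∧ p 1 < h (p 0)} →
    Set.InjOn (fun p : Fin 2 → ℝ => (![p 1, B p] : Fin 2 → ℝ))
      {p : Fin 2 → ℝ | p 0 ∈ Ioo u v ∧ g (p 0) < p 1 ∧ p 1 < h (p 0)}

/-- THE SIGN CELL FOLDS HORIZONTALLY: `PosTwistBandSweepInjective` is FALSE (polynomial datum
`S = a³b − (3/2)a²b + ab²/2 + ab/2`, the sign cell `posCell`, collision `B(1/4, 3/16) = B(3/4, 3/16)`).
Hence the sign-CAD stub of the line must refine its cells in the direction `b` as well before the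
engine applies. [folklore] -/
theorem not_posTwistBandSweepInjective : ¬ PosTwistBandSweepInjective := by
  intro H
  have hcell : {p : Fin 2 → ℝ | p 0 ∈ Ioo aMinus aPlus ∧ hump (p 0) < p 1 ∧ p 1 < (fun a : ℝ => 1 - a) (p 0)}
      = posCell := rfl
  have h := H cellA cellB cellS aMinus aPlus hump (fun a => 1 - a)
    isSemialgebraicFunOn_cellA isSemialgebraicFunOn_cellB continuous_cellA.continuousOn
    continuous_cellB.continuousOn (fun p _ _ _ => hasFDerivAt_cellS p) contDiff_cellA.contDiffOn
    contDiff_cellB.contDiffOn (fun p _ _ _ => by rw [fderiv_cellA_e1, fderiv_cellB_e0])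
    (by obtain ⟨_, h2, h3, _⟩ := aMinus_aPlus_bounds; linarith)
    (by unfold hump; fun_prop) (by fun_prop) (fun a _ => hump_lt_one_sub a)
    (by rw [hcell]; exact posCell_subset_openTriangle)
    (fun a _ => by rw [fderiv_cellA_e1]; exact twist_bottom a) (fun a _ => rfl)
    (fun p h0 h1 h2 => by rw [fderiv_cellA_e1]; exact twist_pos_of_mem_posCell ⟨h0, h1, h2⟩)
    (by rw [hcell]; exact injOn_sweepA_posCell)
  rw [hcell] at h
  exact not_injOn_sweepB_posCell h


/-! # CYCLE 2 — §8 no single twist restores injectivity (the card's headline, refuted for typed data)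

Landed copy: `Theorems/PlanarCompiler/Negative/TwistCusp.lean`. The cusp datum `S = (b − a)√|b − a|`
(triage T3b) is a typed Green datum with two-signed unbounded twist; for EVERY `λ` the vertical sweep
`(a, A + λb)` identifies two points of the fibre `a = 1/4` (IVT on both sides of the cusp). -/

/-! ## §8.0 The cusp profile `φ(x) = x·√|x|` is `C¹` with `φ′(x) = (3/2)√|x|` -/

/-- `φ(x) = x √|x| = sgn(x)|x|^{3/2}`. [folklore] -/
def cuspPhi (x : ℝ) : ℝ := x * Real.sqrt |x|

/-- `φ′(x) = (3/2)√|x|` for every real `x` (including the cusp `x = 0`, where `φ′(0) = 0`). [folklore] -/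
theorem hasDerivAt_cuspPhi (x : ℝ) : HasDerivAt cuspPhi (3 / 2 * Real.sqrt |x|) x := by
  rcases lt_trichotomy x 0 with hx | rfl | hx
  · -- left of the cusp: `φ(y) = y √(−y)`
    have hne : -x ≠ 0 := by linarith
    have h1 : HasDerivAt (fun y : ℝ => Real.sqrt (-y)) (1 / (2 * Real.sqrt (-x)) * (-1)) x :=
      (Real.hasDerivAt_sqrt hne).comp x (hasDerivAt_neg x)
    have h2 := (hasDerivAt_id x).mul h1
    have heq : cuspPhi =ᶠ[𝓝 x] fun y => id y * Real.sqrt (-y) := by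
      filter_upwards [eventually_lt_nhds hx] with y hy
      simp [cuspPhi, abs_of_neg hy]
    refine (h2.congr_of_eventuallyEq heq).congr_deriv ?_
    have hs : 0 < Real.sqrt (-x) := Real.sqrt_pos.mpr (by linarith)
    have hsq : Real.sqrt (-x) ^ 2 = -x := Real.sq_sqrt (by linarith)
    rw [abs_of_neg hx]
    simp only [id]
    field_simp
    linarith [hsq]
  · -- at the cusp: `|φ(h)| = |h|^{3/2} = o(h)`
    simp only [abs_zero, Real.sqrt_zero, mul_zero]
    rw [hasDerivAt_iff_isLittleO_nhds_zero]
    simp only [cuspPhi, zero_add, abs_zero, Real.sqrt_zero, mul_zero, sub_zero, smul_zero]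
    refine Asymptotics.isLittleO_iff.mpr fun ε hε => ?_
    have hev : ∀ᶠ h in 𝓝 (0 : ℝ), |h| < ε ^ 2 := by
      have h0 : Tendsto (fun h : ℝ => |h|) (𝓝 0) (𝓝 0) := by
        simpa using (continuous_abs.tendsto (0 : ℝ))
      exact h0.eventually (eventually_lt_nhds (by positivity))
    filter_upwards [hev] with h hh
    rw [Real.norm_eq_abs, Real.norm_eq_abs, abs_mul, abs_of_nonneg (Real.sqrt_nonneg _)]
    have hs : Real.sqrt |h| ≤ ε := by
      calc Real.sqrt |h| ≤ Real.sqrt (ε ^ 2) := Real.sqrt_le_sqrt hh.le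
        _ = ε := Real.sqrt_sq hε.le
    calc |h| * Real.sqrt |h| ≤ |h| * ε := mul_le_mul_of_nonneg_left hs (abs_nonneg h)
      _ = ε * |h| := mul_comm _ _
  · -- right of the cusp: `φ(y) = y √y`
    have h1 : HasDerivAt (fun y : ℝ => Real.sqrt y) (1 / (2 * Real.sqrt x)) x := Real.hasDerivAt_sqrt hx.ne'
    have h2 := (hasDerivAt_id x).mul h1
    have heq : cuspPhi =ᶠ[𝓝 x] fun y => id y * Real.sqrt y := by
      filter_upwards [eventually_gt_nhds hx] with y hy
      simp [cuspPhi, abs_of_pos hy]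
    refine (h2.congr_of_eventuallyEq heq).congr_deriv ?_
    have hs : 0 < Real.sqrt x := Real.sqrt_pos.mpr hx
    have hsq : Real.sqrt x ^ 2 = x := Real.sq_sqrt hx.le
    rw [abs_of_pos hx]
    simp only [id]
    field_simp
    linarith [hsq]

/-- `φ` is continuous. [folklore] -/
theorem continuous_cuspPhi : Continuous cuspPhi := by unfold cuspPhi; fun_prop

/-! ## §8.1 The cusp Green datum `S = φ(b − a)` -/

/-- `S = (b − a)√|b − a|`. [folklore] -/
def cuspS : (Fin 2 → ℝ) → ℝ := fun p => cuspPhi (p 1 - p 0)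
/-- `A = ∂_aS = −(3/2)√|b − a|`. [folklore] -/
def cuspA : (Fin 2 → ℝ) → ℝ := fun p => -(3 / 2 * Real.sqrt |p 1 - p 0|)
/-- `B = ∂_bS = (3/2)√|b − a|`. [folklore] -/
def cuspB : (Fin 2 → ℝ) → ℝ := fun p => 3 / 2 * Real.sqrt |p 1 - p 0|

/-- `dS = A da + B db` at EVERY point of the plane (so in particular on the open triangle). [folklore] -/
theorem hasFDerivAt_cuspS (p : Fin 2 → ℝ) :
    HasFDerivAt cuspS (cuspA p • ContinuousLinearMap.proj (R := ℝ) (φ := fun _ : Fin 2 => ℝ) 0 +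
      cuspB p • ContinuousLinearMap.proj (R := ℝ) (φ := fun _ : Fin 2 => ℝ) 1) p := by
  have hd : HasFDerivAt (fun q : Fin 2 → ℝ => q 1 - q 0)
      (ContinuousLinearMap.proj (R := ℝ) (φ := fun _ : Fin 2 => ℝ) 1 -
        ContinuousLinearMap.proj (R := ℝ) (φ := fun _ : Fin 2 => ℝ) 0) p :=
    (hasFDerivAt_apply 1 p).sub (hasFDerivAt_apply 0 p)
  have h := (hasDerivAt_cuspPhi (p 1 - p 0)).comp_hasFDerivAt p hd
  refine h.congr_fderiv ?_
  ext v
  simp [cuspA, cuspB]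
  ring

/-- `A` is continuous. [folklore] -/
theorem continuous_cuspA : Continuous cuspA := by unfold cuspA; fun_prop
/-- `B` is continuous. [folklore] -/
theorem continuous_cuspB : Continuous cuspB := by unfold cuspB; fun_prop

/-- `B = (3/2)√|b − a|` is a ℚ-semialgebraic function on the closed triangle (`|·|`, `√·` and products
of semialgebraic functions are semialgebraic — tree facts). [BCR 1998, Prop. 2.2.6] -/
theorem isSemialgebraicFunOn_cuspB : IsSemialgebraicFunOn ℚ triangle cuspB := by
  have h1 : IsSemialgebraicFunOn ℚ triangle (fun p : Fin 2 → ℝ => p 1 - p 0) :=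
    (isSemialgebraicFunOn_aeval isSemialgebraic_triangle (X 1 - X 0)).congr fun p _ => by simp
  have h2 : IsSemialgebraicFunOn ℚ triangle (fun p : Fin 2 → ℝ => Real.sqrt |p 1 - p 0|) :=
    IsSemialgebraicFunOn.sqrt_holds h1.abs
  have h3 : IsSemialgebraicFunOn ℚ triangle (fun _ : Fin 2 → ℝ => (3 / 2 : ℝ)) :=
    (isSemialgebraicFunOn_aeval isSemialgebraic_triangle (C (3 / 2))).congr fun p _ => by simp
  exact (IsSemialgebraicFunOn.mul_holds h3 h2).congr fun p _ => by simp [cuspB]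

/-- `A = −B` is a ℚ-semialgebraic function on the closed triangle. [BCR 1998, Prop. 2.2.6] -/
theorem isSemialgebraicFunOn_cuspA : IsSemialgebraicFunOn ℚ triangle cuspA :=
  isSemialgebraicFunOn_cuspB.neg.congr fun p _ => by simp [cuspA, cuspB]

/-! ## §8.2 On the fibre `a = 1/4`, `b ↦ A + λb` is never injective -/

/-- The sheared fibre map at `a = 1/4`: `F_λ(b) = −(3/2)√|b − 1/4| + λ b`. [folklore] -/
def cuspFibre (lam b : ℝ) : ℝ := -(3 / 2 * Real.sqrt |b - 1 / 4|) + lam * b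

/-- `F_λ` is continuous. [folklore] -/
theorem continuous_cuspFibre (lam : ℝ) : Continuous (cuspFibre lam) := by unfold cuspFibre; fun_prop

/-- The cusp beats every linear term: for `t = min(1/8, 1/(λ²+1))`, `|λ|·t < (3/2)√t`. [folklore] -/
theorem cusp_beats_linear (lam : ℝ) :
    let t := min (1 / 8 : ℝ) (1 / (lam ^ 2 + 1))
    0 < t ∧ t ≤ 1 / 8 ∧ |lam| * t < 3 / 2 * Real.sqrt t := by
  intro t
  have hl : 0 < lam ^ 2 + 1 := by positivity
  have ht0 : 0 < t := lt_min (by norm_num) (by positivity)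
  have ht8 : t ≤ 1 / 8 := min_le_left _ _
  have htl : t ≤ 1 / (lam ^ 2 + 1) := min_le_right _ _
  refine ⟨ht0, ht8, ?_⟩
  have hs : 0 < Real.sqrt t := Real.sqrt_pos.mpr ht0
  have hsq : Real.sqrt t ^ 2 = t := Real.sq_sqrt ht0.le
  -- `lam² t ≤ lam²/(lam²+1) < 1 < 9/4`, hence `(|lam| √t)² < (3/2)²`
  have h1 : lam ^ 2 * t < 9 / 4 := by
    have : lam ^ 2 * t ≤ lam ^ 2 * (1 / (lam ^ 2 + 1)) := mul_le_mul_of_nonneg_left htl (sq_nonneg _)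
    have h2 : lam ^ 2 * (1 / (lam ^ 2 + 1)) < 1 := by
      rw [mul_one_div, div_lt_one hl]; linarith
    linarith
  have h2 : |lam| * Real.sqrt t < 3 / 2 := by
    have habs : 0 ≤ |lam| * Real.sqrt t := by positivity
    nlinarith [sq_abs lam, hsq, habs]
  calc |lam| * t = |lam| * Real.sqrt t * Real.sqrt t := by rw [mul_assoc, ← pow_two, hsq]
    _ < 3 / 2 * Real.sqrt t := mul_lt_mul_of_pos_right h2 hs

/-- TWO DISTINCT POINTS, ONE IMAGE: for every real `λ` there are `b₁ ≠ b₂` in `(0, 3/4)` (the open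
fibre of the triangle over `a = 1/4`) with `F_λ(b₁) = F_λ(b₂)` (IVT on both sides of the cusp). [folklore] -/
theorem exists_ne_cuspFibre_eq (lam : ℝ) :
    ∃ b₁ b₂ : ℝ, b₁ ≠ b₂ ∧ b₁ ∈ Ioo (0 : ℝ) (3 / 4) ∧ b₂ ∈ Ioo (0 : ℝ) (3 / 4) ∧
      cuspFibre lam b₁ = cuspFibre lam b₂ := by
  obtain ⟨ht0, ht8, hbeat⟩ := cusp_beats_linear lam
  set t := min (1 / 8 : ℝ) (1 / (lam ^ 2 + 1)) with ht
  set F := cuspFibre lam with hF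
  have hc : Continuous F := continuous_cuspFibre lam
  have hmid : F (1 / 4) = lam * (1 / 4) := by simp [hF, cuspFibre]
  have hleft : F (1 / 4 - t) < F (1 / 4) := by
    have h : F (1 / 4 - t) = -(3 / 2 * Real.sqrt t) + lam * (1 / 4 - t) := by
      simp only [hF, cuspFibre]
      rw [show (1 / 4 - t - 1 / 4 : ℝ) = -t by ring, abs_neg, abs_of_pos ht0]
    rw [h, hmid]
    nlinarith [neg_abs_le lam, hbeat, ht0]
  have hright : F (1 / 4 + t) < F (1 / 4) := by
    have h : F (1 / 4 + t) = -(3 / 2 * Real.sqrt t) + lam * (1 / 4 + t) := by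
      simp only [hF, cuspFibre]
      rw [show (1 / 4 + t - 1 / 4 : ℝ) = t by ring, abs_of_pos ht0]
    rw [h, hmid]
    nlinarith [le_abs_self lam, hbeat, ht0]
  set y := max (F (1 / 4 - t)) (F (1 / 4 + t)) with hy
  have hy_lt : y < F (1 / 4) := max_lt hleft hright
  obtain ⟨b₁, hb₁, hFb₁⟩ : y ∈ F '' Icc (1 / 4 - t) (1 / 4) :=
    intermediate_value_Icc (by linarith) hc.continuousOn ⟨le_max_left _ _, hy_lt.le⟩
  obtain ⟨b₂, hb₂, hFb₂⟩ : y ∈ F '' Icc (1 / 4) (1 / 4 + t) :=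
    intermediate_value_Icc' (by linarith) hc.continuousOn ⟨le_max_right _ _, hy_lt.le⟩
  refine ⟨b₁, b₂, ?_, ⟨by linarith [hb₁.1], by linarith [hb₁.2]⟩,
    ⟨by linarith [hb₂.1], by linarith [hb₂.2]⟩, by rw [hFb₁, hFb₂]⟩
  rintro rfl
  have hb : b₁ = 1 / 4 := le_antisymm hb₁.2 hb₂.1
  rw [hb] at hFb₁
  exact (lt_irrefl _) (hFb₁ ▸ hy_lt)

/-! ## §8.3 The refuted headline -/

/-- "Twist restoration": for every Green datum as typed in the crux there is a rational `λ` making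
BOTH sheared Lagrangian projections `(a, A + λb)` and `(b, B + λa)` injective on the open triangle
(so that the Green generator would be ONE change-of-variables instance, with no subdivision). -/
def TwistRestoresInjectivity : Prop :=
  ∀ (A B S : (Fin 2 → ℝ) → ℝ),
    IsSemialgebraicFunOn ℚ {p : Fin 2 → ℝ | 0 ≤ p 0 ∧ 0 ≤ p 1 ∧ p 0 + p 1 ≤ 1} A →
    IsSemialgebraicFunOn ℚ {p : Fin 2 → ℝ | 0 ≤ p 0 ∧ 0 ≤ p 1 ∧ p 0 + p 1 ≤ 1} B →
    ContinuousOn A {p : Fin 2 → ℝ | 0 ≤ p 0 ∧ 0 ≤ p 1 ∧ p 0 + p 1 ≤ 1} →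
    ContinuousOn B {p : Fin 2 → ℝ | 0 ≤ p 0 ∧ 0 ≤ p 1 ∧ p 0 + p 1 ≤ 1} →
    (∀ p : Fin 2 → ℝ, 0 < p 0 → 0 < p 1 → p 0 + p 1 < 1 →
      HasFDerivAt S (A p • ContinuousLinearMap.proj (R := ℝ) (φ := fun _ : Fin 2 => ℝ) 0 +
        B p • ContinuousLinearMap.proj (R := ℝ) (φ := fun _ : Fin 2 => ℝ) 1) p) →
    ∃ lam : ℚ, Set.InjOn (fun p : Fin 2 → ℝ => (![p 0, A p + (lam : ℝ) * p 1] : Fin 2 → ℝ))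
        {p : Fin 2 → ℝ | 0 < p 0 ∧ 0 < p 1 ∧ p 0 + p 1 < 1} ∧
      Set.InjOn (fun p : Fin 2 → ℝ => (![p 1, B p + (lam : ℝ) * p 0] : Fin 2 → ℝ))
        {p : Fin 2 → ℝ | 0 < p 0 ∧ 0 < p 1 ∧ p 0 + p 1 < 1}

/-- NO SINGLE TWIST: `TwistRestoresInjectivity` is FALSE — for the cusp datum `S = (b−a)√|b−a|`
and EVERY `λ`, the vertical sweep `(a, A + λb)` identifies two distinct points of the fibre `a = 1/4`.
So "one λ, no subdivision" needs bounded twist (e.g. `A, B` Nash up to the boundary); for the Green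
generator as typed, a subdivision / rectilinearisation step is unavoidable. [folklore] -/
theorem not_twistRestoresInjectivity : ¬ TwistRestoresInjectivity := by
  intro H
  obtain ⟨lam, hinj, -⟩ := H cuspA cuspB cuspS isSemialgebraicFunOn_cuspA isSemialgebraicFunOn_cuspB
    continuous_cuspA.continuousOn continuous_cuspB.continuousOn (fun p _ _ _ => hasFDerivAt_cuspS p)
  obtain ⟨b₁, b₂, hne, hb₁, hb₂, hF⟩ := exists_ne_cuspFibre_eq lam
  have hmem : ∀ b ∈ Ioo (0 : ℝ) (3 / 4),
      (![1 / 4, b] : Fin 2 → ℝ) ∈ {p : Fin 2 → ℝ | 0 < p 0 ∧ 0 < p 1 ∧ p 0 + p 1 < 1} := by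
    intro b hb
    simp only [mem_setOf_eq, Matrix.cons_val_zero, Matrix.cons_val_one]
    exact ⟨by norm_num, hb.1, by linarith [hb.2]⟩
  have key : ∀ b : ℝ, (fun p : Fin 2 → ℝ => (![p 0, cuspA p + (lam : ℝ) * p 1] : Fin 2 → ℝ)) ![1 / 4, b] =
      ![1 / 4, cuspFibre lam b] := by
    intro b; ext i; fin_cases i <;> simp [cuspA, cuspFibre]
  have himg : (fun p : Fin 2 → ℝ => (![p 0, cuspA p + (lam : ℝ) * p 1] : Fin 2 → ℝ)) ![1 / 4, b₁] =
      (fun p : Fin 2 → ℝ => (![p 0, cuspA p + (lam : ℝ) * p 1] : Fin 2 → ℝ)) ![1 / 4, b₂] := by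
    rw [key, key, hF]
  have heq := hinj (hmem b₁ hb₁) (hmem b₂ hb₂) himg
  have h1 := congr_fun heq 1
  simp at h1
  exact hne h1


end Summit.KontsevichZagierPeriods.KontsevichZagierPeriods.Cruxes.PlanarCompiler.Disproof
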